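import Literature.Analysis.FluidPDE.PineauVicolAngularMean
import Literature.Analysis.FluidPDE.NewtonPotentialHolder
import HarnessLib

/-!
# Pineau–Vicol 2026, Lemma 6.3: the pressure half (6.13)–(6.15), the source bound (6.11), and
# Proposition 6.5 (6.20) with its threshold

Analysis/FluidPDE proofs file (theorems only; **no definitions, no named facts**), third of the
§6 files after `PineauVicolAngularEnergy.lean` and `PineauVicolAngularMean.lean`, which list as
"not here" exactly what is supplied now: the pressure half (6.13)–(6.15) of Lemma 6.3, hence
(6.11), and Proposition 6.5 without the hypothesis `h611`.
B. Pineau, V. Vicol, *On rotated backwards self-similar solutions of the incompressible 3D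
Navier–Stokes equations*, arXiv:2607.09619v2 (2026), §6.3 "Estimates for the nonlinearity and the
pressure gradient", Lemma 6.3 and its proof (pp. 20–21); §6.4, Proposition 6.5 and its proof
(p. 22); the decay class (1.9), (2.1), (2.2) of Conjecture 1.1 / Lemma 2.1 (pp. 3, 9).

## The source, as printed (pp. 20–22)

**Lemma 6.3.** "Assume that the smooth incompressible vector field `U : ℝ³ → ℝ³` satisfies the
bounds (1.9) and (2.1). Define `𝓝 := −(U·∇)U − ∇P` (6.10), where `P = RᵢRⱼ(UᵢUⱼ)` (as in the
proof of Lemma 2.1). For any `ε ∈ (0,1]`, there exists a constant `C_ε = C_ε(ε, C_{U,0}) > 0`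
such that `‖(𝓝)_a‖_{L²_μ} ≤ ε + C_ε‖(U)_a‖_{L²_μ} + C_ε‖∇(U)_a‖_{L²_μ}` (6.11)."
Proof of the pressure half (pp. 20–21): "Next, we bound the pressure gradient. Note that we are
seeking a bound in the Gaussian weighted `L²_μ` norm, and so we do not have access to usual
Calderon–Zygmund bounds. This is compensated for by the `ε`-factor present on the right side of
(6.11). Recall that `−ΔP = ∂ᵢ∂ⱼ(UᵢUⱼ)`. Using item (iv) of Lemma 6.1, we obtain
`−Δ(P)_a = (∂ᵢ∂ⱼ(UᵢUⱼ))_a = (∇·∂ⱼ(U Uⱼ))_a = ∇·(∂ⱼ(U Uⱼ))_a = ∇·((U·∇)U)_a`. Since `P`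
decays (recall (2.2)) so does `(P)_a`, and hence `(P)_a = (−Δ)⁻¹∇·((U·∇)U)_a` … Using item (iii)
of Lemma 6.1, we arrive at `(∇P)_a = ∇(P)_a = ∇(−Δ)⁻¹∇·((U·∇)U)_a` (6.13), which is to say that
`(∇P)ⁱ_a = RᵢRⱼVʲ`, where `Vʲ = ((U·∇)U)ʲ_a`, and `Rᵢ, Rⱼ` are Riesz transforms. Note that we have
previously (cf. (6.12)) bounded `‖V‖_{L²_μ}`, and using (6.4), (1.9), (2.1) we obtain that
`|V(y)| ≤ 2C_{U,0}C_{U,1}(1 + |y|³)⁻¹`. Since `μ ≤ 1` and `RᵢRⱼ` is bounded on `L²(ℝ³)`, we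
immediately have `‖RᵢRⱼVʲ‖_{L²_μ} ≤ ‖RᵢRⱼVʲ‖_{L²} ≤ ‖V‖_{L²}`. Then for `L_ε ≥ 1`, to be
determined, we have
`‖V‖_{L²} ≤ ‖1_{|y|≤L_ε}V‖_{L²} + ‖1_{|y|>L_ε}V‖_{L²} ≤ … ≤ e^{L_ε²/8}‖V‖_{L²_μ} + 8C_{U,0}C_{U,1}L_ε^{−3/2}`
(6.14). Therefore, if we let `L_ε := max{1, (24C_{U,0}C_{U,1}/ε)^{2/3}}`, we obtain from
(6.13)–(6.14), together with (6.12), that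
`‖(∇P)_a‖_{L²_μ} ≤ ε + 9e^{L_ε²/8}(C_{U,1}‖(U)_a‖_{L²_μ} + C_{U,0}‖∇(U)_a‖_{L²_μ})` (6.15). Adding
(6.12) and (6.15), and recalling that `C_{U,1} = C_{U,1}(C_{U,0})`, concludes the proof of (6.11)."
**Proposition 6.5.** "Let `α ∈ ℝ` and let `U` be a smooth solution of (6.16) which satisfies the
bounds (1.9) and (2.1). Let `ε ∈ (0,1]` be arbitrary. Then, there exists a constant
`A_ε = A(ε, C_{U,0}) ≥ 1`, such that for all `|α| ≥ A_ε` we have `|α| ‖𝓡U‖_{L²_μ} ≤ ε` (6.20)."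
The decay class (pp. 3, 9): `|U(y)| ≤ C_{U,0}(1+|y|)⁻¹` (1.9); `|∇U(y)| ≤ C_{U,1}(1+|y|²)⁻¹`,
`|∇²U(y)| ≤ C_{U,2}(1+|y|³)⁻¹` (2.1); "for any `σ ∈ (0,1)`, … `|P(y)| ≤ C_{P,0}(1+|y|^{2−σ})⁻¹`"
(2.2); and (proof of Lemma 2.1, p. 9) "`∇·(JU − (Jy·∇)U) = 0` and `∇·(U + (y·∇U)) = 0` when
`∇·U = 0`, and hence `−ΔP = ∂ᵢ∂ⱼ(UᵢUⱼ)`".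

## Rendering (Cartesian, as in the two companion files; `γ = gaussWeight`, `(·)_a = angularFluct(Vec)`)

* **(6.13), the projected Poisson equation**: `laplacian_angularFluct_eq_neg_divergence` —
  `Δ(P)_a = −∇·((U·∇)U)_a` from `ΔP = −∇·((U·∇)U)` (the printed `−ΔP = ∂ᵢ∂ⱼ(UᵢUⱼ)` for
  `∇·U = 0`, in the form the printed chain reaches one step later), by Lemma 6.1 (iv) both halves
  (`angularFluct_laplacian`, `angularFluct_divergence`); and `(∇P)_a = ∇(P)_a` is the tree's
  `angularFluctVec_gradient` (Lemma 6.1 (iii)).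
* **"`RᵢRⱼ` is bounded on `L²(ℝ³)`", in the form used: `‖(∇P)_a‖_{L²_μ} ≤ ‖∇(P)_a‖_{L²} ≤ ‖V‖_{L²}`.**
  The tree has no Riesz transforms on `L²(ℝ³)`; we prove the same inequality (with the constant
  `1` of the Leray–Helmholtz projection, which the printed componentwise count relaxes to `3`) by
  the energy method: `integral_mul_norm_gradient_sq_le_of_laplacian_eq` — for `p ∈ C² ∩ L²`,
  `V ∈ C¹ ∩ L²` with `Δp = −∇·V` and any continuous weight `0 ≤ w ≤ 1` with `w|∇p|² ∈ L¹`,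
  `∫ w|∇p|² ≤ ∫ |V|²`. Proof: test `∇·(∇p + V) = 0` against `χ_R² p` with the tree's cut-offs
  (`integral_mul_divergence_add_eq_zero_left`), Cauchy–Schwarz, `|∇χ_R| ≤ K/R`, and `R → ∞`
  by dominated convergence. This replaces the Calderón–Zygmund input by the shorter road the tree
  provides; it is where "`P` decays (recall (2.2))" enters (`(P)_a ∈ L²`, i.e. (2.2) with
  `σ < 1/2`).
* **(6.14)** `sqrt_integral_norm_sq_le_of_decay` — `‖V‖_{L²} ≤ e^{L²/8}‖V‖_{L²_μ} + 8C L^{−3/2}` for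
  `L ≥ 1` and continuous `V` with `|V(y)| ≤ 2C(1+|y|³)⁻¹` (polar coordinates off the ball,
  `NewtonPotentialHolder.integral_compl_ball_norm_rpow_neg`, `|B₁| = 4π/3`).
* **(6.15)** `PineauVicol2026.pineauVicol_6_15` — as printed, with `L_ε = max{1, (24C_{U,0}C_{U,1}/ε)^{2/3}}`
  (the decay `|V| ≤ 2C_{U,0}C_{U,1}(1+|y|³)⁻¹` of `V = ((U·∇)U)_a` is `norm_angularFluctVec_convect_le`).
* **(6.11)** `PineauVicol2026.pineauVicol_6_11` — with the explicit
  `C_ε = (1 + 9e^{L_ε²/8})(C_{U,1} + 3C_{U,0})`; **Lemma 6.3 as printed** (`∃ C_ε > 0` chosen from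
  `(ε, C_{U,0}, C_{U,1})` before `U`): `PineauVicol2026.pineauVicol_lemma_6_3`.
* **(6.20)** `PineauVicol2026.pineauVicol_prop_6_5` — Proposition 6.5 from (6.11) at level `ε/6`
  and the companion file's `pineauVicol_prop_6_5_of_source_bound`, with the printed threshold
  `A_ε = (27/2)C_{ε/6}²`; **Proposition 6.5 as printed** (`∃ A_ε ≥ 1` before `U`):
  `PineauVicol2026.pineauVicol_prop_6_5_exists`.
* **(6.20) with hypotheses on the profile only**: the polynomial growth of `∇P` assumed by the
  companion file's Lemma 6.4 is read off (6.16a) (`norm_gradient_le_of_profile_equation`: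
  `|∇P(y)| ≤ (|α|(C_{U,0}+C_{U,1}) + C_{U,0} + C_{U,1} + 3C_{U,2} + C_{U,0}C_{U,1})(1+|y|)`), whence
  `PineauVicol2026.pineauVicol_prop_6_5'` / `pineauVicol_prop_6_5_exists'`, in which `P` enters
  only through `P ∈ C²`, the Poisson equation and the decay (2.2).

Hypotheses (deviations from print, all on the side of the printed class). `U ∈ C²`, `P ∈ C²`;
(1.9) and the first half of (2.1) as printed (`‖DU(y)‖` the operator norm); (2.2) for one exponent
`2 − σ = s > 3/2`; the Poisson equation `ΔP = −∇·((U·∇)U)`; for (6.20) in addition the companion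
file's hypotheses of Lemma 6.4 (`|D²U|` as in (2.1), (6.16a) pointwise; the growth of `|∇P|` is
assumed in `pineauVicol_prop_6_5` and derived in `pineauVicol_prop_6_5'`). The
constants depend on `(ε, C_{U,0}, C_{U,1})` — the printed dependence "`C_ε(ε, C_{U,0})`" invokes
`C_{U,1} = C_{U,1}(C_{U,0})` of Lemma 2.1, which is not in the tree.

## References

* B. Pineau, V. Vicol, arXiv:2607.09619v2 (2026): (1.9) p. 3; Lemma 2.1, (2.1)–(2.2) and its
  proof (p. 9); §6.3, Lemma 6.3, (6.10)–(6.15) (pp. 20–21); Proposition 6.5 (6.20) and its proof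
  (p. 22). [PineauVicol2026]
* L. C. Evans, *Partial Differential Equations*, 2nd ed., AMS 2010, App. C.2 (Gauss–Green with
  cut-offs, as in `WholeSpaceIBPIntegrable.lean`). [Evans2010]
-/

noncomputable section

open Set MeasureTheory Filter Real Function Metric
open scoped RealInnerProductSpace ContDiff Topology Laplacian

namespace Literature.Analysis.FluidPDE

namespace PineauVicol2026

/-! ### Tools: Cauchy–Schwarz, a quadratic inequality, linearity of `(·)_a` -/

/-- Cauchy–Schwarz: `∫ ‖f‖ ‖g‖ ≤ √(∫‖f‖²) √(∫‖g‖²)` for continuous `f, g` with integrable squares. [folklore] -/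
private theorem integral_norm_mul_norm_le_sqrt' {F G : Type*} [NormedAddCommGroup F] [NormedSpace ℝ F]
    [NormedAddCommGroup G] [NormedSpace ℝ G] {f : EuclideanSpace ℝ (Fin 3) → F}
    {g : EuclideanSpace ℝ (Fin 3) → G} (hf : Continuous f) (hg : Continuous g)
    (hf2 : Integrable fun x => ‖f x‖ ^ 2) (hg2 : Integrable fun x => ‖g x‖ ^ 2) :
    ∫ x, ‖f x‖ * ‖g x‖ ≤ Real.sqrt (∫ x, ‖f x‖ ^ 2) * Real.sqrt (∫ x, ‖g x‖ ^ 2) := by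
  have hfm : MemLp (fun x => ‖f x‖) (ENNReal.ofReal 2) volume := by
    rw [show ENNReal.ofReal 2 = (2 : ENNReal) by norm_num,
      memLp_two_iff_integrable_sq_norm hf.norm.aestronglyMeasurable]
    exact hf2.congr (Eventually.of_forall fun x => by simp)
  have hgm : MemLp (fun x => ‖g x‖) (ENNReal.ofReal 2) volume := by
    rw [show ENNReal.ofReal 2 = (2 : ENNReal) by norm_num,
      memLp_two_iff_integrable_sq_norm hg.norm.aestronglyMeasurable]
    exact hg2.congr (Eventually.of_forall fun x => by simp)
  have h := integral_mul_le_Lp_mul_Lq_of_nonneg Real.HolderConjugate.two_two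
    (Eventually.of_forall fun x => norm_nonneg (f x)) (Eventually.of_forall fun x => norm_nonneg (g x))
    hfm hgm
  refine h.trans (le_of_eq ?_)
  rw [Real.sqrt_eq_rpow, Real.sqrt_eq_rpow]
  congr 2 <;> exact integral_congr_ae (Eventually.of_forall fun x => by simp)

/-- `|∫ ⟪f, g⟫| ≤ √(∫‖f‖²) √(∫‖g‖²)` for continuous square-integrable fields. [folklore] -/
private theorem abs_integral_inner_le_sqrt' {f g : EuclideanSpace ℝ (Fin 3) → EuclideanSpace ℝ (Fin 3)}
    (hf : Continuous f) (hg : Continuous g)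
    (hf2 : Integrable fun x => ‖f x‖ ^ 2) (hg2 : Integrable fun x => ‖g x‖ ^ 2) :
    |∫ x, ⟪f x, g x⟫| ≤ Real.sqrt (∫ x, ‖f x‖ ^ 2) * Real.sqrt (∫ x, ‖g x‖ ^ 2) := by
  refine le_trans ?_ (integral_norm_mul_norm_le_sqrt' hf hg hf2 hg2)
  rw [← Real.norm_eq_abs]
  refine (norm_integral_le_integral_norm _).trans (integral_mono_of_nonneg
    (Eventually.of_forall fun x => norm_nonneg _) ?_
    (Eventually.of_forall fun x => norm_inner_le_norm _ _))
  -- `‖f‖‖g‖ ≤ (‖f‖² + ‖g‖²)/2`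
  refine Integrable.mono' ((hf2.add hg2).div_const 2) (hf.norm.mul hg.norm).aestronglyMeasurable
    (Eventually.of_forall fun x => ?_)
  simp only [Pi.add_apply]
  rw [Real.norm_of_nonneg (mul_nonneg (norm_nonneg _) (norm_nonneg _))]
  nlinarith [sq_nonneg (‖f x‖ - ‖g x‖)]

/-- From `x² ≤ b x + c` with `b, c ≥ 0`: `x ≤ b + √c`. [folklore] -/
private theorem le_add_sqrt_of_sq_le {x b c : ℝ} (hb : 0 ≤ b) (hc : 0 ≤ c)
    (h : x ^ 2 ≤ b * x + c) : x ≤ b + Real.sqrt c := by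
  by_contra hlt
  rw [not_le] at hlt
  have hs := Real.sq_sqrt hc
  have hs0 := Real.sqrt_nonneg c
  nlinarith [mul_nonneg hb hs0]

/-- `⟨−f⟩_θ = −⟨f⟩_θ`. [folklore] -/
private theorem angularMean_neg (f : EuclideanSpace ℝ (Fin 3) → ℝ) (y : EuclideanSpace ℝ (Fin 3)) :
    angularMean (fun x => -f x) y = -angularMean f y := by
  rw [angularMean_apply, angularMean_apply, intervalIntegral.integral_neg, smul_neg]

/-- `(−f)_a = −(f)_a`. [folklore] -/
private theorem angularFluct_neg (f : EuclideanSpace ℝ (Fin 3) → ℝ) (y : EuclideanSpace ℝ (Fin 3)) :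
    angularFluct (fun x => -f x) y = -angularFluct f y := by
  rw [angularFluct_apply, angularFluct_apply, angularMean_neg]
  ring

/-- `(−V − W)_a = −(V)_a − (W)_a` for continuous vector fields. [folklore] -/
private theorem angularFluctVec_neg_sub {V W : EuclideanSpace ℝ (Fin 3) → EuclideanSpace ℝ (Fin 3)}
    (hV : Continuous V) (hW : Continuous W) (y : EuclideanSpace ℝ (Fin 3)) :
    angularFluctVec (fun x => -V x - W x) y = -angularFluctVec V y - angularFluctVec W y := by
  have h1 : (fun x => -V x - W x) = fun x => (-1 : ℝ) • (fun z => V z + W z) x := by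
    funext x; simp only [smul_add, neg_smul, one_smul]; abel
  rw [angularFluctVec_apply, angularFluctVec_apply, angularFluctVec_apply, h1,
    angularMeanVec_const_smul, angularMeanVec_add hV hW]
  simp only [smul_add, neg_smul, one_smul]
  abel

/-- `‖f‖²` has compact support when `f` does. [folklore] -/
private theorem hasCompactSupport_norm_sq {F : Type*} [NormedAddCommGroup F]
    {f : EuclideanSpace ℝ (Fin 3) → F} (hf : HasCompactSupport f) :
    HasCompactSupport fun y => ‖f y‖ ^ 2 :=
  hf.mono fun y hy => by
    contrapose! hy
    simp only [mem_support, not_not] at hy ⊢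
    rw [hy, norm_zero]
    norm_num

/-- `⟪f, g⟫` has compact support when `f` does. [folklore] -/
private theorem hasCompactSupport_inner_left {f g : EuclideanSpace ℝ (Fin 3) → EuclideanSpace ℝ (Fin 3)}
    (hf : HasCompactSupport f) : HasCompactSupport fun y => ⟪f y, g y⟫ :=
  hf.mono fun y hy => by
    contrapose! hy
    simp only [mem_support, not_not] at hy ⊢
    rw [hy, inner_zero_left]

/-- `⟪f, g⟫` has compact support when `g` does. [folklore] -/
private theorem hasCompactSupport_inner_right {f g : EuclideanSpace ℝ (Fin 3) → EuclideanSpace ℝ (Fin 3)}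
    (hg : HasCompactSupport g) : HasCompactSupport fun y => ⟪f y, g y⟫ :=
  hg.mono fun y hy => by
    contrapose! hy
    simp only [mem_support, not_not] at hy ⊢
    rw [hy, inner_zero_right]

/-! ### (6.13): the projected Poisson equation `Δ(P)_a = −∇·((U·∇)U)_a` -/

/-- `(U·∇)U ∈ C¹` for `U ∈ C²`. [folklore] -/
private theorem contDiff_convect_self {U : EuclideanSpace ℝ (Fin 3) → EuclideanSpace ℝ (Fin 3)}
    (hU : ContDiff ℝ 2 U) : ContDiff ℝ 1 (convect U U) := by
  have h1 : ContDiff ℝ 1 (fderiv ℝ U) := hU.fderiv_right (m := 1) le_rfl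
  have h2 : ContDiff ℝ 1 U := hU.of_le one_le_two
  have : convect U U = fun x => fderiv ℝ U x (U x) := by funext x; rfl
  rw [this]
  exact h1.clm_apply h2

/-- **Pineau–Vicol 2026, proof of Lemma 6.3, the step to (6.13) (pp. 20–21):
`−Δ(P)_a = (∂ᵢ∂ⱼ(UᵢUⱼ))_a = … = ∇·((U·∇)U)_a`** ("using item (iv) of Lemma 6.1"), here from the
Poisson equation in the form `ΔP = −∇·((U·∇)U)` (which is the printed `−ΔP = ∂ᵢ∂ⱼ(UᵢUⱼ)` for
`∇·U = 0`, p. 9), for `U, P ∈ C²`. [cite: PineauVicol2026, proof of Lemma 6.3, display before (6.13) (p. 20)] -/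
theorem laplacian_angularFluct_eq_neg_divergence
    {U : EuclideanSpace ℝ (Fin 3) → EuclideanSpace ℝ (Fin 3)} {P : EuclideanSpace ℝ (Fin 3) → ℝ}
    (hU : ContDiff ℝ 2 U) (hP : ContDiff ℝ 2 P)
    (hPois : ∀ y, Δ P y = -VectorCalculus.divergence (convect U U) y) (y : EuclideanSpace ℝ (Fin 3)) :
    Δ (angularFluct P) y = -VectorCalculus.divergence (angularFluctVec (convect U U)) y := by
  rw [← angularFluct_laplacian hP y, ← angularFluct_divergence (contDiff_convect_self hU) y,
    ← angularFluct_neg]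
  congr 1
  funext x
  exact hPois x

/-! ### "`RᵢRⱼ` is bounded on `L²(ℝ³)`": the energy inequality `∫ w|∇p|² ≤ ∫ |V|²` for `Δp = −∇·V` -/

/-- `⟪∇f(x), w⟫ = Df(x) w`. [folklore] -/
private theorem inner_gradient_left' (f : EuclideanSpace ℝ (Fin 3) → ℝ) (x w : EuclideanSpace ℝ (Fin 3)) :
    ⟪gradient f x, w⟫ = fderiv ℝ f x w := by
  rw [gradient, InnerProductSpace.toDual_symm_apply]

/-- `‖∇f(x)‖ = ‖Df(x)‖`. [folklore] -/
private theorem norm_gradient_eq' (f : EuclideanSpace ℝ (Fin 3) → ℝ) (x : EuclideanSpace ℝ (Fin 3)) :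
    ‖gradient f x‖ = ‖fderiv ℝ f x‖ := by
  rw [gradient]
  exact (InnerProductSpace.toDual ℝ (EuclideanSpace ℝ (Fin 3))).symm.norm_map _

/-- `∇f` is continuous for `f ∈ C¹`. [folklore] -/
private theorem continuous_gradient'' {f : EuclideanSpace ℝ (Fin 3) → ℝ} (hf : ContDiff ℝ 1 f) :
    Continuous (gradient f) :=
  (InnerProductSpace.toDual ℝ (EuclideanSpace ℝ (Fin 3))).symm.continuous.comp
    (hf.continuous_fderiv one_ne_zero)

/-- `∇f ∈ C¹` for `f ∈ C²`. [folklore] -/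
private theorem contDiff_gradient' {f : EuclideanSpace ℝ (Fin 3) → ℝ} (hf : ContDiff ℝ 2 f) :
    ContDiff ℝ 1 (gradient f) :=
  (InnerProductSpace.toDual ℝ (EuclideanSpace ℝ (Fin 3))).symm.contDiff.comp
    (hf.fderiv_right (m := 1) le_rfl)

/-- `∇χ` has compact support when `χ` does. [folklore] -/
private theorem hasCompactSupport_gradient_aux {χ : EuclideanSpace ℝ (Fin 3) → ℝ} (hχc : HasCompactSupport χ) :
    HasCompactSupport (gradient χ) :=
  hχc.mono' fun y hy => by
    contrapose! hy
    simp only [mem_support, not_not]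
    exact gradient_eq_zero_of_notMem_tsupport hy

/-- **The truncated energy identity.** For `p ∈ C²`, `V ∈ C¹` with `Δp = −∇·V` and a cut-off
`χ ∈ C¹_c`: `∫ [χ²(|∇p|² + ⟪∇p, V⟫) + 2χ p (⟪∇χ, ∇p⟫ + ⟪∇χ, V⟫)] = 0` (test `∇·(∇p + V) = 0`
against `χ² p`). [folklore] -/
private theorem truncated_energy_identity {p χ : EuclideanSpace ℝ (Fin 3) → ℝ}
    {V : EuclideanSpace ℝ (Fin 3) → EuclideanSpace ℝ (Fin 3)} (hp : ContDiff ℝ 2 p) (hV : ContDiff ℝ 1 V)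
    (hPois : ∀ y, Δ p y = -VectorCalculus.divergence V y) (hχ : ContDiff ℝ 1 χ)
    (hχc : HasCompactSupport χ) :
    ∫ y, (χ y ^ 2 * (‖gradient p y‖ ^ 2 + ⟪gradient p y, V y⟫) +
      2 * χ y * p y * (⟪gradient χ y, gradient p y⟫ + ⟪gradient χ y, V y⟫)) = 0 := by
  have hp1 : ContDiff ℝ 1 p := hp.of_le one_le_two
  -- `θ = χ (χ p)`, `u = ∇p + V`
  have hθ : ContDiff ℝ 1 (fun y => χ y * (χ y * p y)) := hχ.mul (hχ.mul hp1)
  have hu : ContDiff ℝ 1 (fun y => gradient p y + V y) := (contDiff_gradient' hp).add hV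
  have hc : HasCompactSupport (fun y => χ y * (χ y * p y)) := hχc.mul_right
  have key := integral_mul_divergence_add_eq_zero_left hθ hu hc
  -- `div u = 0`
  have hdiv : VectorCalculus.divergence (fun y => gradient p y + V y) = fun _ => 0 := by
    funext y
    rw [divergence_add_apply (((contDiff_gradient' hp).differentiable one_ne_zero) y)
      ((hV.differentiable one_ne_zero) y), divergence_gradient hp y, hPois y]
    ring
  simp only [hdiv, mul_zero, integral_zero, zero_add] at key
  -- the integrand, pointwise
  have hpt : ∀ y, ⟪gradient p y + V y, gradient (fun y => χ y * (χ y * p y)) y⟫ =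
      χ y ^ 2 * (‖gradient p y‖ ^ 2 + ⟪gradient p y, V y⟫) +
        2 * χ y * p y * (⟪gradient χ y, gradient p y⟫ + ⟪gradient χ y, V y⟫) := by
    intro y
    have hχd : HasFDerivAt χ (fderiv ℝ χ y) y := ((hχ.differentiable one_ne_zero) y).hasFDerivAt
    have hpd : HasFDerivAt p (fderiv ℝ p y) y := ((hp1.differentiable one_ne_zero) y).hasFDerivAt
    have hθd : HasFDerivAt (fun y => χ y * (χ y * p y))
        (χ y • (χ y • fderiv ℝ p y + p y • fderiv ℝ χ y) + (χ y * p y) • fderiv ℝ χ y) y :=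
      hχd.mul (hχd.mul hpd)
    rw [real_inner_comm (gradient (fun y => χ y * (χ y * p y)) y), inner_gradient_left', hθd.fderiv]
    simp only [add_apply, FunLike.coe_smul, Pi.smul_apply,
      smul_eq_mul, map_add, ← inner_gradient_left', real_inner_self_eq_norm_sq]
    ring
  rw [← key]
  exact integral_congr_ae (Eventually.of_forall fun y => (hpt y).symm)

variable {p : EuclideanSpace ℝ (Fin 3) → ℝ} {V : EuclideanSpace ℝ (Fin 3) → EuclideanSpace ℝ (Fin 3)}

/-- **The truncated energy inequality.** With `A = ‖χ∇p‖_{L²}`, `η = ‖p ∇χ‖_{L²}`,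
`W = ‖V‖_{L²}`: `A² ≤ (W + 2η) A + 2η W` (the identity above and Cauchy–Schwarz; `0 ≤ χ ≤ 1`). [folklore] -/
private theorem truncated_energy_ineq (hp : ContDiff ℝ 2 p) (hV : ContDiff ℝ 1 V)
    (hPois : ∀ y, Δ p y = -VectorCalculus.divergence V y) (hV2 : Integrable fun y => ‖V y‖ ^ 2)
    {χ : EuclideanSpace ℝ (Fin 3) → ℝ} (hχ : ContDiff ℝ 1 χ) (hχc : HasCompactSupport χ)
    (hχ0 : ∀ y, 0 ≤ χ y) (hχ1 : ∀ y, χ y ≤ 1) :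
    Real.sqrt (∫ y, ‖χ y • gradient p y‖ ^ 2) ^ 2 ≤
      (Real.sqrt (∫ y, ‖V y‖ ^ 2) + 2 * Real.sqrt (∫ y, ‖p y • gradient χ y‖ ^ 2)) *
          Real.sqrt (∫ y, ‖χ y • gradient p y‖ ^ 2) +
        2 * Real.sqrt (∫ y, ‖p y • gradient χ y‖ ^ 2) * Real.sqrt (∫ y, ‖V y‖ ^ 2) := by
  have hp1 : ContDiff ℝ 1 p := hp.of_le one_le_two
  have cgp : Continuous (gradient p) := continuous_gradient'' hp1
  have cgχ : Continuous (gradient χ) := continuous_gradient'' hχ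
  have cχ : Continuous χ := hχ.continuous
  have cp : Continuous p := hp.continuous
  have cV : Continuous V := hV.continuous
  -- the three fields `f = χ∇p`, `g = χV`, `h = p∇χ`
  have cf : Continuous fun y => χ y • gradient p y := cχ.smul cgp
  have cg : Continuous fun y => χ y • V y := cχ.smul cV
  have ch : Continuous fun y => p y • gradient χ y := cp.smul cgχ
  have fc : HasCompactSupport fun y => χ y • gradient p y := hχc.smul_right (f' := gradient p)
  have gc : HasCompactSupport fun y => χ y • V y := hχc.smul_right (f' := V)
  have hc' : HasCompactSupport fun y => p y • gradient χ y :=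
    (hasCompactSupport_gradient_aux hχc).smul_left (f := p)
  have f2 : Integrable fun y => ‖χ y • gradient p y‖ ^ 2 :=
    (cf.norm.pow 2).integrable_of_hasCompactSupport (hasCompactSupport_norm_sq fc)
  have g2 : Integrable fun y => ‖χ y • V y‖ ^ 2 :=
    (cg.norm.pow 2).integrable_of_hasCompactSupport (hasCompactSupport_norm_sq gc)
  have h2 : Integrable fun y => ‖p y • gradient χ y‖ ^ 2 :=
    (ch.norm.pow 2).integrable_of_hasCompactSupport (hasCompactSupport_norm_sq hc')
  have ifg : Integrable fun y => ⟪χ y • gradient p y, χ y • V y⟫ :=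
    (cf.inner cg).integrable_of_hasCompactSupport (hasCompactSupport_inner_left fc)
  have ihf : Integrable fun y => ⟪p y • gradient χ y, χ y • gradient p y⟫ :=
    (ch.inner cf).integrable_of_hasCompactSupport (hasCompactSupport_inner_right fc)
  have ihg : Integrable fun y => ⟪p y • gradient χ y, χ y • V y⟫ :=
    (ch.inner cg).integrable_of_hasCompactSupport (hasCompactSupport_inner_right gc)
  -- `‖g‖_{L²} ≤ ‖V‖_{L²}`
  have hgV : Real.sqrt (∫ y, ‖χ y • V y‖ ^ 2) ≤ Real.sqrt (∫ y, ‖V y‖ ^ 2) := by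
    refine Real.sqrt_le_sqrt (integral_mono g2 hV2 fun y => ?_)
    have e : ‖χ y • V y‖ ^ 2 = χ y ^ 2 * ‖V y‖ ^ 2 := by
      rw [norm_smul, mul_pow, Real.norm_of_nonneg (hχ0 y)]
    have : χ y ^ 2 ≤ 1 := by nlinarith [hχ0 y, hχ1 y]
    simp only [e]
    nlinarith [sq_nonneg ‖V y‖]
  -- the identity, split into four integrals
  have i12 : Integrable (fun y => ‖χ y • gradient p y‖ ^ 2 + ⟪χ y • gradient p y, χ y • V y⟫) :=
    (f2.add ifg :)
  have i3 : Integrable (fun y => 2 * ⟪p y • gradient χ y, χ y • gradient p y⟫) := ihf.const_mul 2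
  have i4 : Integrable (fun y => 2 * ⟪p y • gradient χ y, χ y • V y⟫) := ihg.const_mul 2
  have i123 : Integrable (fun y => ‖χ y • gradient p y‖ ^ 2 + ⟪χ y • gradient p y, χ y • V y⟫ +
      2 * ⟪p y • gradient χ y, χ y • gradient p y⟫) := (i12.add i3 :)
  have iden : (∫ y, ‖χ y • gradient p y‖ ^ 2) + (∫ y, ⟪χ y • gradient p y, χ y • V y⟫) +
      2 * (∫ y, ⟪p y • gradient χ y, χ y • gradient p y⟫) +
      2 * (∫ y, ⟪p y • gradient χ y, χ y • V y⟫) = 0 := by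
    have e := truncated_energy_identity hp hV hPois hχ hχc
    have ept : (fun y => χ y ^ 2 * (‖gradient p y‖ ^ 2 + ⟪gradient p y, V y⟫) +
        2 * χ y * p y * (⟪gradient χ y, gradient p y⟫ + ⟪gradient χ y, V y⟫)) =
        fun y => ‖χ y • gradient p y‖ ^ 2 + ⟪χ y • gradient p y, χ y • V y⟫ +
          2 * ⟪p y • gradient χ y, χ y • gradient p y⟫ + 2 * ⟪p y • gradient χ y, χ y • V y⟫ := by
      funext y
      simp only [norm_smul, real_inner_smul_left, real_inner_smul_right, mul_pow,
        Real.norm_of_nonneg (hχ0 y)]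
      ring
    rw [ept, integral_add i123 i4, integral_add i12 i3, integral_add f2 ifg,
      MeasureTheory.integral_const_mul, MeasureTheory.integral_const_mul] at e
    exact e
  -- Cauchy–Schwarz on the three pairings
  have c1 := abs_integral_inner_le_sqrt' cf cg f2 g2
  have c2 := abs_integral_inner_le_sqrt' ch cf h2 f2
  have c3 := abs_integral_inner_le_sqrt' ch cg h2 g2
  have eA : ∫ y, ‖χ y • gradient p y‖ ^ 2 = Real.sqrt (∫ y, ‖χ y • gradient p y‖ ^ 2) ^ 2 :=
    (Real.sq_sqrt (integral_nonneg fun y => sq_nonneg _)).symm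
  rw [eA] at iden
  have hA0 : 0 ≤ Real.sqrt (∫ y, ‖χ y • gradient p y‖ ^ 2) := Real.sqrt_nonneg _
  have hH0 : 0 ≤ Real.sqrt (∫ y, ‖p y • gradient χ y‖ ^ 2) := Real.sqrt_nonneg _
  have b1 := c1.trans (mul_le_mul_of_nonneg_left hgV hA0)
  have b3 := c3.trans (mul_le_mul_of_nonneg_left hgV hH0)
  have a1 := neg_le_abs (∫ y, ⟪χ y • gradient p y, χ y • V y⟫)
  have a2 := neg_le_abs (∫ y, ⟪p y • gradient χ y, χ y • gradient p y⟫)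
  have a3 := neg_le_abs (∫ y, ⟪p y • gradient χ y, χ y • V y⟫)
  linarith [b1, c2, b3, a1, a2, a3, iden]

/-- `‖χ_R G‖²` is integrable for continuous `G` (compact support). [folklore] -/
private theorem integrable_norm_sq_cutoff_smul {G : EuclideanSpace ℝ (Fin 3) → EuclideanSpace ℝ (Fin 3)}
    (hG : Continuous G) {R : ℝ} (hR : 0 < R) :
    Integrable fun y => ‖cutoff R y • G y‖ ^ 2 :=
  (((contDiff_cutoff (n := 0) R).continuous.smul hG).norm.pow 2).integrable_of_hasCompactSupport
    (hasCompactSupport_norm_sq ((hasCompactSupport_cutoff hR).smul_right))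

/-- **"Since `μ ≤ 1` and `RᵢRⱼ` is bounded on `L²(ℝ³)`, … `‖RᵢRⱼVʲ‖_{L²_μ} ≤ ‖RᵢRⱼVʲ‖_{L²} ≤ ‖V‖_{L²}`"
(Pineau–Vicol 2026, proof of Lemma 6.3, p. 21), energy form.** Let `p ∈ C²(ℝ³) ∩ L²`,
`V ∈ C¹(ℝ³; ℝ³) ∩ L²` with `Δp = −∇·V` (so that `∇p = ∇(−Δ)⁻¹∇·V = (RᵢRⱼVʲ)ᵢ` is the gradient
part of `−V`), and let `w` be a continuous weight with `0 ≤ w ≤ 1` and `w|∇p|² ∈ L¹`. Then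
`∫ w |∇p|² ≤ ∫ |V|²`. The tree has no Riesz transforms on `L²(ℝ³)`; the proof here is the energy
method: `∇·(∇p + V) = 0` tested against `χ_R² p` (`integral_mul_divergence_add_eq_zero_left`),
Cauchy–Schwarz, `|∇χ_R| ≤ K/R`, `R → ∞`. [cite: PineauVicol2026, proof of Lemma 6.3, (6.13) and the display after it (p. 21)] -/
theorem integral_mul_norm_gradient_sq_le_of_laplacian_eq (hp : ContDiff ℝ 2 p) (hV : ContDiff ℝ 1 V)
    (hPois : ∀ y, Δ p y = -VectorCalculus.divergence V y)
    (hp2 : Integrable fun y => p y ^ 2) (hV2 : Integrable fun y => ‖V y‖ ^ 2)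
    {w : EuclideanSpace ℝ (Fin 3) → ℝ} (hw : Continuous w) (hw0 : ∀ y, 0 ≤ w y) (hw1 : ∀ y, w y ≤ 1)
    (hwi : Integrable fun y => w y * ‖gradient p y‖ ^ 2) :
    ∫ y, w y * ‖gradient p y‖ ^ 2 ≤ ∫ y, ‖V y‖ ^ 2 := by
  obtain ⟨K, hK0, hK⟩ := exists_norm_fderiv_cutoff_le (E := EuclideanSpace ℝ (Fin 3))
  have hp1 : ContDiff ℝ 1 p := hp.of_le one_le_two
  have cgp : Continuous (gradient p) := continuous_gradient'' hp1
  have hW0 : 0 ≤ Real.sqrt (∫ y, ‖V y‖ ^ 2) := Real.sqrt_nonneg _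
  have eW : ∫ y, ‖V y‖ ^ 2 = Real.sqrt (∫ y, ‖V y‖ ^ 2) ^ 2 :=
    (Real.sq_sqrt (integral_nonneg fun y => sq_nonneg _)).symm
  -- `η_n ≤ K ‖p‖_{L²} / (n+1)`
  have hη : ∀ n : ℕ, Real.sqrt (∫ y, ‖p y • gradient (cutoff ((n : ℝ) + 1)) y‖ ^ 2) ≤
      K / ((n : ℝ) + 1) * Real.sqrt (∫ y, p y ^ 2) := by
    intro n
    have hR : (0 : ℝ) < (n : ℝ) + 1 := by positivity
    have hpt : ∀ y, ‖p y • gradient (cutoff ((n : ℝ) + 1)) y‖ ^ 2 ≤ (K / ((n : ℝ) + 1)) ^ 2 * p y ^ 2 := by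
      intro y
      rw [norm_smul, mul_pow, Real.norm_eq_abs, sq_abs, norm_gradient_eq']
      have h1 := hK _ hR y
      have h0 : 0 ≤ ‖fderiv ℝ (cutoff ((n : ℝ) + 1)) y‖ := norm_nonneg _
      have h2 := pow_le_pow_left₀ h0 h1 2
      nlinarith [sq_nonneg (p y)]
    have hint : ∫ y, ‖p y • gradient (cutoff ((n : ℝ) + 1)) y‖ ^ 2 ≤ (K / ((n : ℝ) + 1)) ^ 2 * ∫ y, p y ^ 2 := by
      rw [← MeasureTheory.integral_const_mul]
      exact integral_mono_of_nonneg (Eventually.of_forall fun y => by positivity) (hp2.const_mul _)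
        (Eventually.of_forall hpt)
    calc Real.sqrt (∫ y, ‖p y • gradient (cutoff ((n : ℝ) + 1)) y‖ ^ 2)
        ≤ Real.sqrt ((K / ((n : ℝ) + 1)) ^ 2 * ∫ y, p y ^ 2) := Real.sqrt_le_sqrt hint
      _ = K / ((n : ℝ) + 1) * Real.sqrt (∫ y, p y ^ 2) := by
          rw [Real.sqrt_mul' _ (integral_nonneg fun y => sq_nonneg _), Real.sqrt_sq (by positivity)]
  -- abbreviation for the bound `B_n = W + 2η̄_n + √(2η̄_n W)` with `η̄_n = K‖p‖/(n+1)`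
  have hA : ∀ n : ℕ, Real.sqrt (∫ y, ‖cutoff ((n : ℝ) + 1) y • gradient p y‖ ^ 2) ≤
      Real.sqrt (∫ y, ‖V y‖ ^ 2) + 2 * (K / ((n : ℝ) + 1) * Real.sqrt (∫ y, p y ^ 2)) +
        Real.sqrt (2 * (K / ((n : ℝ) + 1) * Real.sqrt (∫ y, p y ^ 2)) * Real.sqrt (∫ y, ‖V y‖ ^ 2)) := by
    intro n
    have hR : (0 : ℝ) < (n : ℝ) + 1 := by positivity
    have h := truncated_energy_ineq hp hV hPois hV2 (contDiff_cutoff _) (hasCompactSupport_cutoff hR)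
      (cutoff_nonneg _) (cutoff_le_one _)
    have hηn := hη n
    have hη0 : 0 ≤ Real.sqrt (∫ y, ‖p y • gradient (cutoff ((n : ℝ) + 1)) y‖ ^ 2) := Real.sqrt_nonneg _
    generalize Real.sqrt (∫ y, ‖p y • gradient (cutoff ((n : ℝ) + 1)) y‖ ^ 2) = η at *
    generalize Real.sqrt (∫ y, ‖cutoff ((n : ℝ) + 1) y • gradient p y‖ ^ 2) = A at *
    generalize Real.sqrt (∫ y, ‖V y‖ ^ 2) = W at *
    generalize K / ((n : ℝ) + 1) * Real.sqrt (∫ y, p y ^ 2) = η' at *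
    have h1 : A ≤ (W + 2 * η) + Real.sqrt (2 * η * W) :=
      le_add_sqrt_of_sq_le (by positivity) (by positivity) h
    have e1 : 2 * η * W ≤ 2 * η' * W := by nlinarith
    have e2 := Real.sqrt_le_sqrt e1
    linarith
  -- `I_n ≤ B_n²`
  have hI : ∀ n : ℕ, ∫ y, w y * (cutoff ((n : ℝ) + 1) y ^ 2 * ‖gradient p y‖ ^ 2) ≤
      (Real.sqrt (∫ y, ‖V y‖ ^ 2) + 2 * (K / ((n : ℝ) + 1) * Real.sqrt (∫ y, p y ^ 2)) +
        Real.sqrt (2 * (K / ((n : ℝ) + 1) * Real.sqrt (∫ y, p y ^ 2)) * Real.sqrt (∫ y, ‖V y‖ ^ 2))) ^ 2 := by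
    intro n
    have hR : (0 : ℝ) < (n : ℝ) + 1 := by positivity
    have hpt : ∀ y, w y * (cutoff ((n : ℝ) + 1) y ^ 2 * ‖gradient p y‖ ^ 2) ≤
        ‖cutoff ((n : ℝ) + 1) y • gradient p y‖ ^ 2 := by
      intro y
      rw [norm_smul, mul_pow, Real.norm_of_nonneg (cutoff_nonneg _ _)]
      have : 0 ≤ cutoff ((n : ℝ) + 1) y ^ 2 * ‖gradient p y‖ ^ 2 := by positivity
      nlinarith [hw0 y, hw1 y]
    calc ∫ y, w y * (cutoff ((n : ℝ) + 1) y ^ 2 * ‖gradient p y‖ ^ 2)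
        ≤ ∫ y, ‖cutoff ((n : ℝ) + 1) y • gradient p y‖ ^ 2 :=
          integral_mono_of_nonneg (Eventually.of_forall fun y => by
              exact mul_nonneg (hw0 y) (by positivity))
            (integrable_norm_sq_cutoff_smul cgp hR) (Eventually.of_forall hpt)
      _ = Real.sqrt (∫ y, ‖cutoff ((n : ℝ) + 1) y • gradient p y‖ ^ 2) ^ 2 :=
          (Real.sq_sqrt (integral_nonneg fun y => sq_nonneg _)).symm
      _ ≤ _ := pow_le_pow_left₀ (Real.sqrt_nonneg _) (hA n) 2
  -- limits: `I_n → ∫ w|∇p|²`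
  have hlim1 : Tendsto (fun n : ℕ => ∫ y, w y * (cutoff ((n : ℝ) + 1) y ^ 2 * ‖gradient p y‖ ^ 2))
      atTop (𝓝 (∫ y, w y * ‖gradient p y‖ ^ 2)) := by
    refine tendsto_integral_of_dominated_convergence (fun y => w y * ‖gradient p y‖ ^ 2)
      (fun n => (hw.mul (((contDiff_cutoff (n := 0) _).continuous.pow 2).mul
        (cgp.norm.pow 2))).aestronglyMeasurable) hwi ?_ ?_
    · intro n
      filter_upwards with y
      have h0 : 0 ≤ cutoff ((n : ℝ) + 1) y ^ 2 * ‖gradient p y‖ ^ 2 := by positivity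
      rw [Real.norm_of_nonneg (mul_nonneg (hw0 y) h0)]
      have h1 : cutoff ((n : ℝ) + 1) y ^ 2 ≤ 1 := by
        nlinarith [cutoff_nonneg ((n : ℝ) + 1) y, cutoff_le_one ((n : ℝ) + 1) y]
      have h2 : cutoff ((n : ℝ) + 1) y ^ 2 * ‖gradient p y‖ ^ 2 ≤ ‖gradient p y‖ ^ 2 := by
        nlinarith [sq_nonneg ‖gradient p y‖]
      exact mul_le_mul_of_nonneg_left h2 (hw0 y)
    · filter_upwards with y
      have := (((tendsto_cutoff_natCast_add_one y).pow 2).mul_const (‖gradient p y‖ ^ 2)).const_mul (w y)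
      simpa using this
  -- limits: `B_n² → W²`
  have hlim2 : Tendsto (fun n : ℕ =>
      (Real.sqrt (∫ y, ‖V y‖ ^ 2) + 2 * (K / ((n : ℝ) + 1) * Real.sqrt (∫ y, p y ^ 2)) +
        Real.sqrt (2 * (K / ((n : ℝ) + 1) * Real.sqrt (∫ y, p y ^ 2)) * Real.sqrt (∫ y, ‖V y‖ ^ 2))) ^ 2)
      atTop (𝓝 (Real.sqrt (∫ y, ‖V y‖ ^ 2) ^ 2)) := by
    have h0 : Tendsto (fun n : ℕ => K / ((n : ℝ) + 1) * Real.sqrt (∫ y, p y ^ 2)) atTop (𝓝 0) := by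
      have h := tendsto_one_div_add_atTop_nhds_zero_nat.const_mul (K * Real.sqrt (∫ y, p y ^ 2))
      rw [mul_zero] at h
      refine h.congr fun n => ?_
      simp only [one_div]
      ring
    have hs : Tendsto (fun n : ℕ => Real.sqrt (2 * (K / ((n : ℝ) + 1) * Real.sqrt (∫ y, p y ^ 2)) *
        Real.sqrt (∫ y, ‖V y‖ ^ 2))) atTop (𝓝 0) := by
      have h := ((h0.const_mul 2).mul_const (Real.sqrt (∫ y, ‖V y‖ ^ 2))).sqrt
      simpa using h
    have h1 := ((tendsto_const_nhds (x := Real.sqrt (∫ y, ‖V y‖ ^ 2))).add (h0.const_mul 2)).add hs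
    simp only [mul_zero, add_zero] at h1
    exact h1.pow 2
  have hle := le_of_tendsto_of_tendsto' hlim1 hlim2 hI
  rw [eW]
  exact hle

/-! ### (6.14): `‖V‖_{L²} ≤ e^{L²/8}‖V‖_{L²_μ} + 8 C L^{−3/2}` for `|V| ≤ 2C(1+|y|³)⁻¹` -/

/-- `√(a + b) ≤ √a + √b`. [folklore] -/
private theorem sqrt_add_le' {a b : ℝ} (ha : 0 ≤ a) (hb : 0 ≤ b) :
    Real.sqrt (a + b) ≤ Real.sqrt a + Real.sqrt b := by
  rw [Real.sqrt_le_left (add_nonneg (Real.sqrt_nonneg _) (Real.sqrt_nonneg _)), add_sq,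
    Real.sq_sqrt ha, Real.sq_sqrt hb]
  nlinarith [Real.sqrt_nonneg a, Real.sqrt_nonneg b]

/-- `(1 + a)³ ≤ 4 (1 + a³)` for `a ≥ 0`. [folklore] -/
private theorem one_add_pow_three_le {a : ℝ} (ha : 0 ≤ a) : (1 + a) ^ 3 ≤ 4 * (1 + a ^ 3) := by
  nlinarith [sq_nonneg (1 - a), mul_nonneg ha (sq_nonneg (1 - a))]

/-- A field with `|V(y)| ≤ 2C(1+|y|³)⁻¹` is square integrable on `ℝ³`. [folklore] -/
private theorem integrable_norm_sq_of_decay {V : EuclideanSpace ℝ (Fin 3) → EuclideanSpace ℝ (Fin 3)}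
    (hV : Continuous V) {C : ℝ} (hVb : ∀ y, ‖V y‖ ≤ 2 * C / (1 + ‖y‖ ^ 3)) :
    Integrable fun y => ‖V y‖ ^ 2 := by
  have hC : 0 ≤ C := by
    have h := (norm_nonneg _).trans (hVb 0)
    rw [norm_zero] at h
    norm_num at h
    linarith
  have hI : Integrable fun y : EuclideanSpace ℝ (Fin 3) => (1 + ‖y‖) ^ (-(6 : ℝ)) := by
    refine integrable_one_add_norm ?_
    rw [finrank_euclideanSpace_fin]
    norm_num
  refine Integrable.mono' (hI.const_mul (64 * C ^ 2)) (hV.norm.pow 2).aestronglyMeasurable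
    (Eventually.of_forall fun y => ?_)
  rw [Real.norm_of_nonneg (sq_nonneg _)]
  have ha : 0 ≤ ‖y‖ := norm_nonneg y
  have h1 : 0 < 1 + ‖y‖ ^ 3 := by positivity
  have h2 : 0 < 1 + ‖y‖ := by positivity
  have h3 := one_add_pow_three_le ha
  have hpow : (1 + ‖y‖) ^ (-(6 : ℝ)) = ((1 + ‖y‖) ^ 6)⁻¹ := by
    rw [Real.rpow_neg h2.le, show (6 : ℝ) = ((6 : ℕ) : ℝ) by norm_num, Real.rpow_natCast]
  rw [hpow]
  have hb := hVb y
  have hV0 : 0 ≤ ‖V y‖ := norm_nonneg _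
  -- `‖V‖ ≤ 2C/(1+a³) ≤ 8C/(1+a)³`
  have h4 : ‖V y‖ ≤ 8 * C / (1 + ‖y‖) ^ 3 := by
    refine hb.trans ?_
    rw [div_le_div_iff₀ h1 (by positivity)]
    nlinarith [h3, hC]
  have h5 : ‖V y‖ ^ 2 ≤ (8 * C / (1 + ‖y‖) ^ 3) ^ 2 := pow_le_pow_left₀ hV0 h4 2
  refine h5.trans (le_of_eq ?_)
  field_simp
  ring

/-- `|B₁| = 4π/3` in `ℝ³`, hence `|B₁| ≤ 16/3`. [folklore] -/
private theorem volume_real_ball_one_le :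
    (volume : Measure (EuclideanSpace ℝ (Fin 3))).real (ball 0 1) ≤ 16 / 3 := by
  rw [measureReal_def, EuclideanSpace.volume_ball_fin_three, ENNReal.toReal_mul,
    ← ENNReal.ofReal_pow zero_le_one, one_pow, ENNReal.toReal_ofReal zero_le_one,
    ENNReal.toReal_ofReal (by positivity : (0 : ℝ) ≤ π * 4 / 3)]
  nlinarith [Real.pi_le_four]

/-- **Pineau–Vicol 2026, proof of Lemma 6.3, (6.14) (p. 21)**: for `L ≥ 1` and a continuous field
with "`|V(y)| ≤ 2C_{U,0}C_{U,1}(1 + |y|³)⁻¹`" (here `C = C_{U,0}C_{U,1}`),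
`‖V‖_{L²} ≤ ‖1_{|y|≤L}V‖_{L²} + ‖1_{|y|>L}V‖_{L²} ≤ ‖1_{|y|≤L}μ^{−1/2}‖_{L^∞}‖μ^{1/2}V‖_{L²} + 2C‖1_{|y|>L}|y|⁻³‖_{L²} ≤ e^{L²/8}‖V‖_{L²_μ} + 8C L^{−3/2}`
(polar coordinates off the ball: `∫_{|y|≥L}|y|⁻⁶ = (4π/3)L⁻³`). [cite: PineauVicol2026, proof of Lemma 6.3, (6.14) (p. 21)] -/
theorem sqrt_integral_norm_sq_le_of_decay {V : EuclideanSpace ℝ (Fin 3) → EuclideanSpace ℝ (Fin 3)}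
    (hV : Continuous V) {C : ℝ} (hVb : ∀ y, ‖V y‖ ≤ 2 * C / (1 + ‖y‖ ^ 3)) {L : ℝ} (hL : 1 ≤ L) :
    Real.sqrt (∫ y, ‖V y‖ ^ 2) ≤
      Real.exp (L ^ 2 / 8) * Real.sqrt (∫ y, gaussWeight y * ‖V y‖ ^ 2) + 8 * C * L ^ (-(3 : ℝ) / 2) := by
  have hC : 0 ≤ C := by
    have h := (norm_nonneg _).trans (hVb 0)
    rw [norm_zero] at h
    norm_num at h
    linarith
  have hL0 : 0 < L := by linarith
  have hV2 := integrable_norm_sq_of_decay hV hVb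
  have hγV2 : Integrable fun y => gaussWeight y * ‖V y‖ ^ 2 := by
    refine integrable_gaussWeight_mul_of_norm_le (hV.norm.pow 2) (C := (2 * C) ^ 2) (N := 0) fun y => ?_
    rw [norm_pow, norm_norm, pow_zero, mul_one]
    refine pow_le_pow_left₀ (norm_nonneg _) ((hVb y).trans ?_) 2
    rw [div_le_iff₀ (by positivity)]
    nlinarith [pow_nonneg (norm_nonneg y) 3]
  set G := ∫ y, gaussWeight y * ‖V y‖ ^ 2 with hG
  have hG0 : 0 ≤ G := integral_nonneg fun y => mul_nonneg (gaussWeight_pos y).le (sq_nonneg _)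
  -- the ball part
  have hball : ∫ y in ball (0 : EuclideanSpace ℝ (Fin 3)) L, ‖V y‖ ^ 2 ≤ Real.exp (L ^ 2 / 4) * G := by
    have h1 : ∫ y in ball (0 : EuclideanSpace ℝ (Fin 3)) L, ‖V y‖ ^ 2 ≤
        ∫ y in ball (0 : EuclideanSpace ℝ (Fin 3)) L, Real.exp (L ^ 2 / 4) * (gaussWeight y * ‖V y‖ ^ 2) := by
      refine setIntegral_mono_on hV2.integrableOn (hγV2.const_mul _).integrableOn measurableSet_ball
        fun y hy => ?_
      rw [mem_ball_zero_iff] at hy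
      have hγ : 1 ≤ Real.exp (L ^ 2 / 4) * gaussWeight y := by
        rw [gaussWeight, ← Real.exp_add]
        refine Real.one_le_exp ?_
        have : ‖y‖ ^ 2 ≤ L ^ 2 := pow_le_pow_left₀ (norm_nonneg _) hy.le 2
        linarith
      nlinarith [sq_nonneg ‖V y‖]
    have h2 : ∫ y in ball (0 : EuclideanSpace ℝ (Fin 3)) L, Real.exp (L ^ 2 / 4) * (gaussWeight y * ‖V y‖ ^ 2)
        ≤ ∫ y, Real.exp (L ^ 2 / 4) * (gaussWeight y * ‖V y‖ ^ 2) :=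
      setIntegral_le_integral (hγV2.const_mul _) (Eventually.of_forall fun y =>
        mul_nonneg (Real.exp_pos _).le (mul_nonneg (gaussWeight_pos y).le (sq_nonneg _)))
    have h3 : ∫ y, Real.exp (L ^ 2 / 4) * (gaussWeight y * ‖V y‖ ^ 2) = Real.exp (L ^ 2 / 4) * G :=
      MeasureTheory.integral_const_mul _ _
    exact h1.trans (h2.trans h3.le)
  -- the far part
  have hfar : ∫ y in (ball (0 : EuclideanSpace ℝ (Fin 3)) L)ᶜ, ‖V y‖ ^ 2 ≤ 64 * C ^ 2 * L ^ (-(3 : ℝ)) := by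
    have h1 : ∫ y in (ball (0 : EuclideanSpace ℝ (Fin 3)) L)ᶜ, ‖V y‖ ^ 2 ≤
        ∫ y in (ball (0 : EuclideanSpace ℝ (Fin 3)) L)ᶜ, 4 * C ^ 2 * ‖y‖ ^ (-(6 : ℝ)) := by
      refine setIntegral_mono_on hV2.integrableOn
        ((NewtonPotentialHolder.integrableOn_compl_ball_norm_rpow_neg (by norm_num) hL0).const_mul _)
        measurableSet_ball.compl fun y hy => ?_
      rw [mem_compl_iff, mem_ball_zero_iff, not_lt] at hy
      have hy0 : 0 < ‖y‖ := hL0.trans_le hy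
      have hpow : ‖y‖ ^ (-(6 : ℝ)) = (‖y‖ ^ 6)⁻¹ := by
        rw [Real.rpow_neg hy0.le, show (6 : ℝ) = ((6 : ℕ) : ℝ) by norm_num, Real.rpow_natCast]
      rw [hpow]
      have hb := hVb y
      have h3 : ‖V y‖ ≤ 2 * C / ‖y‖ ^ 3 := by
        refine hb.trans (div_le_div_of_nonneg_left (by positivity) (by positivity) ?_)
        linarith
      have h4 : ‖V y‖ ^ 2 ≤ (2 * C / ‖y‖ ^ 3) ^ 2 := pow_le_pow_left₀ (norm_nonneg _) h3 2
      refine h4.trans (le_of_eq ?_)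
      field_simp
      ring
    have h2 : ∫ y in (ball (0 : EuclideanSpace ℝ (Fin 3)) L)ᶜ, 4 * C ^ 2 * ‖y‖ ^ (-(6 : ℝ)) =
        4 * C ^ 2 * (3 * (volume : Measure (EuclideanSpace ℝ (Fin 3))).real (ball 0 1) *
          (L ^ (3 - (6 : ℝ)) / ((6 : ℝ) - 3))) := by
      rw [MeasureTheory.integral_const_mul, NewtonPotentialHolder.integral_compl_ball_norm_rpow_neg
        (by norm_num) hL0]
    rw [h2] at h1
    refine h1.trans ?_
    have hv := volume_real_ball_one_le
    have hv0 : 0 ≤ (volume : Measure (EuclideanSpace ℝ (Fin 3))).real (ball 0 1) := measureReal_nonneg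
    have hL3 : 0 ≤ L ^ (-(3 : ℝ)) := Real.rpow_nonneg hL0.le _
    rw [show (3 : ℝ) - 6 = -3 by norm_num, show (6 : ℝ) - 3 = 3 by norm_num]
    nlinarith [mul_nonneg (sq_nonneg C) hL3, mul_nonneg (mul_nonneg (sq_nonneg C) hL3) hv0]
  -- add up
  have hsplit := integral_add_compl (μ := volume) measurableSet_ball hV2
    (s := ball (0 : EuclideanSpace ℝ (Fin 3)) L)
  have htot : ∫ y, ‖V y‖ ^ 2 ≤ Real.exp (L ^ 2 / 4) * G + 64 * C ^ 2 * L ^ (-(3 : ℝ)) := by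
    rw [← hsplit]; exact add_le_add hball hfar
  have hE : Real.sqrt (Real.exp (L ^ 2 / 4) * G) = Real.exp (L ^ 2 / 8) * Real.sqrt G := by
    rw [Real.sqrt_mul (Real.exp_pos _).le,
      show Real.exp (L ^ 2 / 4) = Real.exp (L ^ 2 / 8) ^ 2 by rw [← Real.exp_nat_mul]; ring_nf,
      Real.sqrt_sq (Real.exp_pos _).le]
  have hT : Real.sqrt (64 * C ^ 2 * L ^ (-(3 : ℝ))) = 8 * C * L ^ (-(3 : ℝ) / 2) := by
    have : 64 * C ^ 2 * L ^ (-(3 : ℝ)) = (8 * C * L ^ (-(3 : ℝ) / 2)) ^ 2 := by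
      rw [mul_pow, mul_pow, ← Real.rpow_natCast (L ^ (-(3 : ℝ) / 2)) 2, ← Real.rpow_mul hL0.le]
      norm_num
    rw [this, Real.sqrt_sq (by positivity)]
  calc Real.sqrt (∫ y, ‖V y‖ ^ 2)
      ≤ Real.sqrt (Real.exp (L ^ 2 / 4) * G + 64 * C ^ 2 * L ^ (-(3 : ℝ))) := Real.sqrt_le_sqrt htot
    _ ≤ Real.sqrt (Real.exp (L ^ 2 / 4) * G) + Real.sqrt (64 * C ^ 2 * L ^ (-(3 : ℝ))) :=
        sqrt_add_le' (by positivity) (by positivity)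
    _ = Real.exp (L ^ 2 / 8) * Real.sqrt G + 8 * C * L ^ (-(3 : ℝ) / 2) := by rw [hE, hT]

/-! ### (6.15): the pressure half, as printed -/

/-- `(1 + a)^s ≤ 2^s (1 + a^s)` for `a, s ≥ 0`. [folklore] -/
private theorem one_add_rpow_le {a s : ℝ} (ha : 0 ≤ a) (hs : 0 ≤ s) :
    (1 + a) ^ s ≤ 2 ^ s * (1 + a ^ s) := by
  have has : 0 ≤ a ^ s := Real.rpow_nonneg ha s
  have h2s : 0 ≤ (2 : ℝ) ^ s := Real.rpow_nonneg (by norm_num) s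
  rcases le_total a 1 with h | h
  · calc (1 + a) ^ s ≤ 2 ^ s := Real.rpow_le_rpow (by positivity) (by linarith) hs
      _ ≤ 2 ^ s * (1 + a ^ s) := by nlinarith
  · calc (1 + a) ^ s ≤ (2 * a) ^ s := Real.rpow_le_rpow (by positivity) (by linarith) hs
      _ = 2 ^ s * a ^ s := Real.mul_rpow (by norm_num) ha
      _ ≤ 2 ^ s * (1 + a ^ s) := by nlinarith

/-- `(P)_a ∈ L²` under (2.2) with `2 − σ = s > 3/2`. [folklore] -/
private theorem integrable_sq_angularFluct_of_decay {P : EuclideanSpace ℝ (Fin 3) → ℝ} (hP : Continuous P)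
    {CP s : ℝ} (hs : 3 / 2 < s) (h22 : ∀ y, |P y| ≤ CP / (1 + ‖y‖ ^ s)) :
    Integrable fun y => angularFluct P y ^ 2 := by
  have hs0 : 0 ≤ s := by linarith
  have hCP : 0 ≤ CP := by
    have h := (abs_nonneg _).trans (h22 0)
    rw [norm_zero, Real.zero_rpow (by linarith)] at h
    norm_num at h
    exact h
  have hI : Integrable fun y : EuclideanSpace ℝ (Fin 3) => (1 + ‖y‖) ^ (-(2 * s)) := by
    refine integrable_one_add_norm ?_
    rw [finrank_euclideanSpace_fin]
    push_cast
    linarith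
  have hb : ∀ y, ‖angularFluct P y‖ ≤ 2 * (CP / (1 + ‖y‖ ^ s)) := fun y =>
    norm_angularFluct_le (b := fun r => CP / (1 + r ^ s)) (fun x => by
      rw [Real.norm_eq_abs]; exact h22 x) y
  refine Integrable.mono' (hI.const_mul ((2 * CP * 2 ^ s) ^ 2))
    ((contDiff_angularFluct (n := 0) (contDiff_zero.2 hP)).continuous.pow 2).aestronglyMeasurable (Eventually.of_forall fun y => ?_)
  rw [Real.norm_of_nonneg (sq_nonneg _)]
  have ha : 0 ≤ ‖y‖ := norm_nonneg y
  have h1 : 0 < 1 + ‖y‖ ^ s := by positivity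
  have h2 : 0 < (1 + ‖y‖) ^ s := by positivity
  have h3 := one_add_rpow_le ha hs0
  -- `|p| ≤ 2CP/(1+a^s) ≤ 2CP 2^s (1+a)^{-s}`
  have h4 : ‖angularFluct P y‖ ≤ 2 * CP * 2 ^ s * (1 + ‖y‖) ^ (-s) := by
    refine (hb y).trans ?_
    rw [Real.rpow_neg (by positivity)]
    have key : CP / (1 + ‖y‖ ^ s) ≤ CP * 2 ^ s / (1 + ‖y‖) ^ s := by
      rw [div_le_div_iff₀ h1 h2]
      have := mul_le_mul_of_nonneg_left h3 hCP
      linarith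
    calc 2 * (CP / (1 + ‖y‖ ^ s)) ≤ 2 * (CP * 2 ^ s / (1 + ‖y‖) ^ s) := by linarith
      _ = 2 * CP * 2 ^ s * ((1 + ‖y‖) ^ s)⁻¹ := by rw [div_eq_mul_inv]; ring
  have h5 : ‖angularFluct P y‖ ^ 2 ≤ (2 * CP * 2 ^ s * (1 + ‖y‖) ^ (-s)) ^ 2 :=
    pow_le_pow_left₀ (norm_nonneg _) h4 2
  rw [Real.norm_eq_abs, sq_abs] at h5
  refine h5.trans (le_of_eq ?_)
  rw [mul_pow, ← Real.rpow_natCast ((1 + ‖y‖) ^ (-s)) 2, ← Real.rpow_mul (by positivity)]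
  congr 2
  push_cast
  ring

/-- The decay of `V = ((U·∇)U)_a`: "using (6.4), (1.9), (2.1) we obtain that
`|V(y)| ≤ 2C_{U,0}C_{U,1}(1 + |y|³)⁻¹`". [cite: PineauVicol2026, proof of Lemma 6.3 (p. 21)] -/
theorem norm_angularFluctVec_convect_le {U : EuclideanSpace ℝ (Fin 3) → EuclideanSpace ℝ (Fin 3)}
    {C₀ C₁ : ℝ} (h19 : ∀ y, ‖U y‖ ≤ C₀ / (1 + ‖y‖)) (h21 : ∀ y, ‖fderiv ℝ U y‖ ≤ C₁ / (1 + ‖y‖ ^ 2))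
    (y : EuclideanSpace ℝ (Fin 3)) :
    ‖angularFluctVec (convect U U) y‖ ≤ 2 * (C₀ * C₁) / (1 + ‖y‖ ^ 3) := by
  have hC0 : 0 ≤ C₀ := by
    have h := (norm_nonneg _).trans (h19 0); rw [norm_zero] at h; norm_num at h; exact h
  have hC1 : 0 ≤ C₁ := by
    have h := (norm_nonneg _).trans (h21 0); rw [norm_zero] at h; norm_num at h; exact h
  have hb : ∀ x, ‖convect U U x‖ ≤ C₀ * C₁ / (1 + ‖x‖ ^ 3) := by
    intro x
    have ha : 0 ≤ ‖x‖ := norm_nonneg x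
    rw [convect_apply]
    calc ‖fderiv ℝ U x (U x)‖ ≤ ‖fderiv ℝ U x‖ * ‖U x‖ := ContinuousLinearMap.le_opNorm _ _
      _ ≤ (C₁ / (1 + ‖x‖ ^ 2)) * (C₀ / (1 + ‖x‖)) :=
          mul_le_mul (h21 x) (h19 x) (norm_nonneg _) (by positivity)
      _ = C₀ * C₁ / ((1 + ‖x‖ ^ 2) * (1 + ‖x‖)) := by rw [div_mul_div_comm, mul_comm C₁]
      _ ≤ C₀ * C₁ / (1 + ‖x‖ ^ 3) := by
          refine div_le_div_of_nonneg_left (by positivity) (by positivity) ?_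
          nlinarith [sq_nonneg ‖x‖, ha]
  have h := norm_angularFluctVec_le (b := fun r => C₀ * C₁ / (1 + r ^ 3)) hb y
  rw [mul_div_assoc]
  simpa using h

/-- The explicit length `L_ε = max{1, (24 C_{U,0}C_{U,1}/ε)^{2/3}}` of the printed proof kills the
tail: `8 C_{U,0}C_{U,1} L_ε^{−3/2} ≤ ε/3`. [folklore] -/
private theorem tail_le_of_Leps {M ε : ℝ} (hM : 0 ≤ M) (hε : 0 < ε) :
    8 * M * (max 1 ((24 * M / ε) ^ ((2 : ℝ) / 3))) ^ (-(3 : ℝ) / 2) ≤ ε / 3 := by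
  set L := max 1 ((24 * M / ε) ^ ((2 : ℝ) / 3)) with hL
  have hL1 : 1 ≤ L := le_max_left _ _
  have hL0 : 0 < L := by linarith
  rcases hM.eq_or_lt with h | h
  · rw [← h]; norm_num; positivity
  · have hq : 0 < 24 * M / ε := by positivity
    -- `L^{3/2} ≥ 24M/ε`
    have h1 : 24 * M / ε ≤ L ^ ((3 : ℝ) / 2) := by
      have h2 : (24 * M / ε) ^ ((2 : ℝ) / 3) ≤ L := le_max_right _ _
      have h3 := Real.rpow_le_rpow (Real.rpow_nonneg hq.le _) h2 (by norm_num : (0 : ℝ) ≤ 3 / 2)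
      rwa [← Real.rpow_mul hq.le, show (2 : ℝ) / 3 * (3 / 2) = 1 by norm_num, Real.rpow_one] at h3
    have h4 : L ^ (-(3 : ℝ) / 2) = (L ^ ((3 : ℝ) / 2))⁻¹ := by
      rw [show -(3 : ℝ) / 2 = -((3 : ℝ) / 2) by ring, Real.rpow_neg hL0.le]
    rw [h4]
    have h5 : 0 < L ^ ((3 : ℝ) / 2) := Real.rpow_pos_of_pos hL0 _
    rw [mul_inv_le_iff₀ h5]
    calc 8 * M = ε / 3 * (24 * M / ε) := by field_simp; ring
      _ ≤ ε / 3 * L ^ ((3 : ℝ) / 2) := mul_le_mul_of_nonneg_left h1 (by positivity)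

/-- **Pineau–Vicol 2026, Lemma 6.3, the pressure estimate (6.15) (p. 21), as printed**:
`‖(∇P)_a‖_{L²_μ} ≤ ε + 9 e^{L_ε²/8} (C_{U,1}‖(U)_a‖_{L²_μ} + C_{U,0}‖∇(U)_a‖_{L²_μ})`,
`L_ε = max{1, (24C_{U,0}C_{U,1}/ε)^{2/3}}`, for `U, P ∈ C²` in the decay class (1.9), (2.1) (first
half), (2.2) (one exponent `s = 2 − σ > 3/2`), with the Poisson equation `ΔP = −∇·((U·∇)U)` and
`∇P` of polynomial growth. Printed route: (6.13), "`RᵢRⱼ` bounded on `L²`" (here the energy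
inequality `integral_mul_norm_gradient_sq_le_of_laplacian_eq`), (6.14), the choice of `L_ε`, and
(6.12) (`sqrt_integral_gaussWeight_mul_norm_sq_angularFluctVec_convect_le`). Here
`‖∇(U)_a‖²_{L²_μ} = ∫ γ Σᵢ |∂ᵢ(U)_a|²` as in the companion file. [cite: PineauVicol2026, Lemma 6.3, (6.13)–(6.15) (pp. 20–21)] -/
theorem pineauVicol_6_15 {U : EuclideanSpace ℝ (Fin 3) → EuclideanSpace ℝ (Fin 3)}
    {P : EuclideanSpace ℝ (Fin 3) → ℝ} (hU : ContDiff ℝ 2 U) (hP : ContDiff ℝ 2 P) {C₀ C₁ CP s : ℝ}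
    (h19 : ∀ y, ‖U y‖ ≤ C₀ / (1 + ‖y‖)) (h21 : ∀ y, ‖fderiv ℝ U y‖ ≤ C₁ / (1 + ‖y‖ ^ 2))
    (hs : 3 / 2 < s) (h22 : ∀ y, |P y| ≤ CP / (1 + ‖y‖ ^ s))
    (hPois : ∀ y, Δ P y = -VectorCalculus.divergence (convect U U) y)
    {C : ℝ} {N : ℕ} (hP1 : ∀ y, ‖gradient P y‖ ≤ C * (1 + ‖y‖) ^ N) {ε : ℝ} (hε : 0 < ε) :
    Real.sqrt (∫ y, gaussWeight y * ‖angularFluctVec (gradient P) y‖ ^ 2) ≤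
      ε + 9 * Real.exp ((max 1 ((24 * (C₀ * C₁) / ε) ^ ((2 : ℝ) / 3))) ^ 2 / 8) *
        (C₁ * Real.sqrt (∫ y, gaussWeight y * ‖angularFluctVec U y‖ ^ 2) +
          C₀ * Real.sqrt (∫ y, gaussWeight y *
            ∑ i, ‖fderiv ℝ (angularFluctVec U) y (EuclideanSpace.basisFun (Fin 3) ℝ i)‖ ^ 2)) := by
  have hC0 : 0 ≤ C₀ := by
    have h := (norm_nonneg _).trans (h19 0); rw [norm_zero] at h; norm_num at h; exact h
  have hC1 : 0 ≤ C₁ := by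
    have h := (norm_nonneg _).trans (h21 0); rw [norm_zero] at h; norm_num at h; exact h
  have hU1 : ContDiff ℝ 1 U := hU.of_le one_le_two
  have hP1' : ContDiff ℝ 1 P := hP.of_le one_le_two
  -- uniform bounds `‖U‖ ≤ C₀`, `‖DU‖ ≤ C₁`
  have h0 : ∀ y, ‖U y‖ ≤ C₀ := fun y =>
    (h19 y).trans (div_le_self hC0 (by linarith [norm_nonneg y]))
  have h1 : ∀ y, ‖fderiv ℝ U y‖ ≤ C₁ := fun y =>
    (h21 y).trans (div_le_self hC1 (by nlinarith [norm_nonneg y]))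
  -- `p = (P)_a`, `V = ((U·∇)U)_a`
  have hp : ContDiff ℝ 2 (angularFluct P) := contDiff_angularFluct hP
  have hW : ContDiff ℝ 1 (convect U U) := contDiff_convect_self hU
  have hV : ContDiff ℝ 1 (angularFluctVec (convect U U)) := contDiff_angularFluctVec hW
  have hPois' := laplacian_angularFluct_eq_neg_divergence hU hP hPois
  have hp2 := integrable_sq_angularFluct_of_decay hP.continuous hs h22
  have hVb := norm_angularFluctVec_convect_le h19 h21
  have hV2 := integrable_norm_sq_of_decay hV.continuous hVb
  -- `γ|∇p|² ∈ L¹`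
  have hgp : ∀ y, ‖angularFluctVec (gradient P) y‖ ≤ 2 * (C * (1 + ‖y‖) ^ N) := fun y =>
    norm_angularFluctVec_le (b := fun r => C * (1 + r) ^ N) hP1 y
  have hwi : Integrable fun y => gaussWeight y * ‖gradient (angularFluct P) y‖ ^ 2 := by
    rw [← angularFluctVec_gradient hP1']
    refine integrable_gaussWeight_mul_of_norm_le
      ((contDiff_angularFluctVec (contDiff_gradient' hP)).continuous.norm.pow 2)
      (C := (2 * C) ^ 2) (N := 2 * N) fun y => ?_
    rw [norm_pow, norm_norm]
    calc ‖angularFluctVec (gradient P) y‖ ^ 2 ≤ (2 * (C * (1 + ‖y‖) ^ N)) ^ 2 :=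
          pow_le_pow_left₀ (norm_nonneg _) (hgp y) 2
      _ = (2 * C) ^ 2 * (1 + ‖y‖) ^ (2 * N) := by ring
  -- the energy inequality with `w = γ`: `‖(∇P)_a‖_{L²_μ} ≤ ‖V‖_{L²}`
  have hE := integral_mul_norm_gradient_sq_le_of_laplacian_eq hp hV hPois' hp2 hV2
    (contDiff_gaussWeight (n := 0)).continuous (fun y => (gaussWeight_pos y).le) gaussWeight_le_one hwi
  rw [angularFluctVec_gradient hP1']
  -- (6.14) and (6.12)
  set L := max 1 ((24 * (C₀ * C₁) / ε) ^ ((2 : ℝ) / 3)) with hL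
  have hL1 : 1 ≤ L := le_max_left _ _
  have h614 := sqrt_integral_norm_sq_le_of_decay hV.continuous hVb hL1
  have h612 := sqrt_integral_gaussWeight_mul_norm_sq_angularFluctVec_convect_le hU1 h0 h1
  have htail := tail_le_of_Leps (mul_nonneg hC0 hC1) hε
  rw [← hL] at htail
  have hexp : 0 ≤ Real.exp (L ^ 2 / 8) := (Real.exp_pos _).le
  have hUa : 0 ≤ Real.sqrt (∫ y, gaussWeight y * ‖angularFluctVec U y‖ ^ 2) := Real.sqrt_nonneg _
  have hGa : 0 ≤ Real.sqrt (∫ y, gaussWeight y *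
      ∑ i, ‖fderiv ℝ (angularFluctVec U) y (EuclideanSpace.basisFun (Fin 3) ℝ i)‖ ^ 2) :=
    Real.sqrt_nonneg _
  have hx1 := mul_nonneg hexp (mul_nonneg hC1 hUa)
  have hx2 := mul_nonneg hexp (mul_nonneg hC0 hGa)
  calc Real.sqrt (∫ y, gaussWeight y * ‖gradient (angularFluct P) y‖ ^ 2)
      ≤ Real.sqrt (∫ y, ‖angularFluctVec (convect U U) y‖ ^ 2) := Real.sqrt_le_sqrt hE
    _ ≤ Real.exp (L ^ 2 / 8) * Real.sqrt (∫ y, gaussWeight y * ‖angularFluctVec (convect U U) y‖ ^ 2) +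
          8 * (C₀ * C₁) * L ^ (-(3 : ℝ) / 2) := h614
    _ ≤ Real.exp (L ^ 2 / 8) * (C₁ * Real.sqrt (∫ y, gaussWeight y * ‖angularFluctVec U y‖ ^ 2) +
          3 * C₀ * Real.sqrt (∫ y, gaussWeight y *
            ∑ i, ‖fderiv ℝ (angularFluctVec U) y (EuclideanSpace.basisFun (Fin 3) ℝ i)‖ ^ 2)) + ε / 3 :=
        add_le_add (mul_le_mul_of_nonneg_left h612 hexp) htail
    _ ≤ _ := by nlinarith [hx1, hx2]

/-! ### (6.11): Lemma 6.3 -/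

/-- Minkowski in `L²_μ`: `‖A + B‖_{L²_μ} ≤ ‖A‖_{L²_μ} + ‖B‖_{L²_μ}` for continuous fields with
`γ|A|², γ|B|² ∈ L¹`. [folklore] -/
private theorem sqrt_integral_gaussWeight_norm_add_sq_le'
    {A B : EuclideanSpace ℝ (Fin 3) → EuclideanSpace ℝ (Fin 3)} (hA : Continuous A) (hB : Continuous B)
    (iA : Integrable fun y => gaussWeight y * ‖A y‖ ^ 2)
    (iB : Integrable fun y => gaussWeight y * ‖B y‖ ^ 2) :
    Real.sqrt (∫ y, gaussWeight y * ‖A y + B y‖ ^ 2) ≤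
      Real.sqrt (∫ y, gaussWeight y * ‖A y‖ ^ 2) + Real.sqrt (∫ y, gaussWeight y * ‖B y‖ ^ 2) := by
  have cγ : Continuous fun y : EuclideanSpace ℝ (Fin 3) => Real.sqrt (gaussWeight y) :=
    Real.continuous_sqrt.comp (contDiff_gaussWeight (n := 0)).continuous
  have ef : ∀ y, ‖Real.sqrt (gaussWeight y) • A y‖ ^ 2 = gaussWeight y * ‖A y‖ ^ 2 := fun y => by
    rw [norm_smul, mul_pow, Real.norm_of_nonneg (Real.sqrt_nonneg _), Real.sq_sqrt (gaussWeight_pos y).le]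
  have eg : ∀ y, ‖Real.sqrt (gaussWeight y) • B y‖ ^ 2 = gaussWeight y * ‖B y‖ ^ 2 := fun y => by
    rw [norm_smul, mul_pow, Real.norm_of_nonneg (Real.sqrt_nonneg _), Real.sq_sqrt (gaussWeight_pos y).le]
  have efg : ∀ y, ‖Real.sqrt (gaussWeight y) • A y‖ * ‖Real.sqrt (gaussWeight y) • B y‖ =
      gaussWeight y * (‖A y‖ * ‖B y‖) := fun y => by
    rw [norm_smul, norm_smul, Real.norm_of_nonneg (Real.sqrt_nonneg _)]
    calc Real.sqrt (gaussWeight y) * ‖A y‖ * (Real.sqrt (gaussWeight y) * ‖B y‖)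
        = (Real.sqrt (gaussWeight y) * Real.sqrt (gaussWeight y)) * (‖A y‖ * ‖B y‖) := by ring
      _ = gaussWeight y * (‖A y‖ * ‖B y‖) := by rw [Real.mul_self_sqrt (gaussWeight_pos y).le]
  have f2 : Integrable fun y => ‖Real.sqrt (gaussWeight y) • A y‖ ^ 2 :=
    iA.congr (Eventually.of_forall fun y => (ef y).symm)
  have g2 : Integrable fun y => ‖Real.sqrt (gaussWeight y) • B y‖ ^ 2 :=
    iB.congr (Eventually.of_forall fun y => (eg y).symm)
  have cf : Continuous fun y => Real.sqrt (gaussWeight y) • A y := cγ.smul hA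
  have cg : Continuous fun y => Real.sqrt (gaussWeight y) • B y := cγ.smul hB
  have hcs := integral_norm_mul_norm_le_sqrt' cf cg f2 g2
  rw [funext efg, funext ef, funext eg] at hcs
  -- `∫ γ‖A+B‖² ≤ X + 2 ∫ γ‖A‖‖B‖ + Y`
  set X := ∫ y, gaussWeight y * ‖A y‖ ^ 2 with hX
  set Y := ∫ y, gaussWeight y * ‖B y‖ ^ 2 with hY
  set Z := ∫ y, gaussWeight y * (‖A y‖ * ‖B y‖) with hZ
  have hX0 : 0 ≤ X := integral_nonneg fun y => mul_nonneg (gaussWeight_pos y).le (sq_nonneg _)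
  have hY0 : 0 ≤ Y := integral_nonneg fun y => mul_nonneg (gaussWeight_pos y).le (sq_nonneg _)
  have iZ : Integrable fun y => gaussWeight y * (‖A y‖ * ‖B y‖) := by
    refine Integrable.mono' ((iA.add iB).div_const 2)
      ((contDiff_gaussWeight (n := 0)).continuous.mul (hA.norm.mul hB.norm)).aestronglyMeasurable
      (Eventually.of_forall fun y => ?_)
    simp only [Pi.add_apply]
    rw [Real.norm_of_nonneg (mul_nonneg (gaussWeight_pos y).le (mul_nonneg (norm_nonneg _) (norm_nonneg _)))]
    nlinarith [mul_nonneg (gaussWeight_pos y).le (sq_nonneg (‖A y‖ - ‖B y‖))]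
  have iS : Integrable fun y => gaussWeight y * ‖A y + B y‖ ^ 2 := by
    refine Integrable.mono' ((iA.add iB).const_mul 2)
      ((contDiff_gaussWeight (n := 0)).continuous.mul ((hA.add hB).norm.pow 2)).aestronglyMeasurable
      (Eventually.of_forall fun y => ?_)
    simp only [Pi.add_apply]
    rw [Real.norm_of_nonneg (mul_nonneg (gaussWeight_pos y).le (sq_nonneg _))]
    have h1 : ‖A y + B y‖ ≤ ‖A y‖ + ‖B y‖ := norm_add_le _ _
    have h2 : ‖A y + B y‖ ^ 2 ≤ (‖A y‖ + ‖B y‖) ^ 2 := pow_le_pow_left₀ (norm_nonneg _) h1 2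
    nlinarith [mul_le_mul_of_nonneg_left h2 (gaussWeight_pos y).le,
      mul_nonneg (gaussWeight_pos y).le (sq_nonneg (‖A y‖ - ‖B y‖))]
  have hle : ∫ y, gaussWeight y * ‖A y + B y‖ ^ 2 ≤ X + 2 * Z + Y := by
    have i1 : Integrable fun y => gaussWeight y * ‖A y‖ ^ 2 + 2 * (gaussWeight y * (‖A y‖ * ‖B y‖)) :=
      (iA.add (iZ.const_mul 2) :)
    rw [hX, hZ, hY, ← MeasureTheory.integral_const_mul, ← integral_add iA (iZ.const_mul 2),
      ← integral_add i1 iB]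
    refine integral_mono iS (i1.add iB :) fun y => ?_
    have h1 : ‖A y + B y‖ ≤ ‖A y‖ + ‖B y‖ := norm_add_le _ _
    have h2 : ‖A y + B y‖ ^ 2 ≤ (‖A y‖ + ‖B y‖) ^ 2 := pow_le_pow_left₀ (norm_nonneg _) h1 2
    have h3 := mul_le_mul_of_nonneg_left h2 (gaussWeight_pos y).le
    nlinarith [h3]
  have hZle : Z ≤ Real.sqrt X * Real.sqrt Y := by
    have := hcs
    refine le_trans (le_of_eq ?_) this
    rfl
  calc Real.sqrt (∫ y, gaussWeight y * ‖A y + B y‖ ^ 2) ≤ Real.sqrt ((Real.sqrt X + Real.sqrt Y) ^ 2) := by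
        refine Real.sqrt_le_sqrt (hle.trans ?_)
        rw [add_sq, Real.sq_sqrt hX0, Real.sq_sqrt hY0]
        nlinarith [hZle]
    _ = Real.sqrt X + Real.sqrt Y := Real.sqrt_sq (add_nonneg (Real.sqrt_nonneg _) (Real.sqrt_nonneg _))

/-- **Pineau–Vicol 2026, Lemma 6.3 (6.11) with the explicit constant of the printed proof**:
"Adding (6.12) and (6.15) … concludes the proof of (6.11)" — for `U, P ∈ C²` in the decay class
(1.9), (2.1) (first half), (2.2) (one exponent `s = 2 − σ > 3/2`), with the Poisson equation
`ΔP = −∇·((U·∇)U)` and `∇P` of polynomial growth, and every `ε > 0`: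
`‖(𝓝)_a‖_{L²_μ} ≤ ε + C_ε‖(U)_a‖_{L²_μ} + C_ε‖∇(U)_a‖_{L²_μ}` with `𝓝 = −(U·∇)U − ∇P` and
`C_ε = (1 + 9e^{L_ε²/8})(C_{U,1} + 3C_{U,0})`, `L_ε = max{1, (24C_{U,0}C_{U,1}/ε)^{2/3}}`.
[cite: PineauVicol2026, Lemma 6.3, (6.11) (p. 20)] -/
theorem pineauVicol_6_11 {U : EuclideanSpace ℝ (Fin 3) → EuclideanSpace ℝ (Fin 3)}
    {P : EuclideanSpace ℝ (Fin 3) → ℝ} (hU : ContDiff ℝ 2 U) (hP : ContDiff ℝ 2 P) {C₀ C₁ CP s : ℝ}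
    (h19 : ∀ y, ‖U y‖ ≤ C₀ / (1 + ‖y‖)) (h21 : ∀ y, ‖fderiv ℝ U y‖ ≤ C₁ / (1 + ‖y‖ ^ 2))
    (hs : 3 / 2 < s) (h22 : ∀ y, |P y| ≤ CP / (1 + ‖y‖ ^ s))
    (hPois : ∀ y, Δ P y = -VectorCalculus.divergence (convect U U) y)
    {C : ℝ} {N : ℕ} (hP1 : ∀ y, ‖gradient P y‖ ≤ C * (1 + ‖y‖) ^ N) {ε : ℝ} (hε : 0 < ε) :
    Real.sqrt (∫ y, gaussWeight y *
        ‖angularFluctVec (fun x => -(convect U U x) - gradient P x) y‖ ^ 2) ≤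
      ε + (1 + 9 * Real.exp ((max 1 ((24 * (C₀ * C₁) / ε) ^ ((2 : ℝ) / 3))) ^ 2 / 8)) * (C₁ + 3 * C₀) *
          Real.sqrt (∫ y, gaussWeight y * ‖angularFluctVec U y‖ ^ 2) +
        (1 + 9 * Real.exp ((max 1 ((24 * (C₀ * C₁) / ε) ^ ((2 : ℝ) / 3))) ^ 2 / 8)) * (C₁ + 3 * C₀) *
          Real.sqrt (∫ y, gaussWeight y *
            ∑ i, ‖fderiv ℝ (angularFluctVec U) y (EuclideanSpace.basisFun (Fin 3) ℝ i)‖ ^ 2) := by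
  have hC0 : 0 ≤ C₀ := by
    have h := (norm_nonneg _).trans (h19 0); rw [norm_zero] at h; norm_num at h; exact h
  have hC1 : 0 ≤ C₁ := by
    have h := (norm_nonneg _).trans (h21 0); rw [norm_zero] at h; norm_num at h; exact h
  have hU1 : ContDiff ℝ 1 U := hU.of_le one_le_two
  have hP1' : ContDiff ℝ 1 P := hP.of_le one_le_two
  have h0 : ∀ y, ‖U y‖ ≤ C₀ := fun y =>
    (h19 y).trans (div_le_self hC0 (by linarith [norm_nonneg y]))
  have h1 : ∀ y, ‖fderiv ℝ U y‖ ≤ C₁ := fun y =>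
    (h21 y).trans (div_le_self hC1 (by nlinarith [norm_nonneg y]))
  have hW : ContDiff ℝ 1 (convect U U) := contDiff_convect_self hU
  have cA : Continuous (angularFluctVec (convect U U)) := (contDiff_angularFluctVec hW).continuous
  have cB : Continuous (angularFluctVec (gradient P)) :=
    (contDiff_angularFluctVec (contDiff_gradient' hP)).continuous
  -- `(𝓝)_a = −((U·∇)U)_a − (∇P)_a`
  have hsplit : ∀ y, angularFluctVec (fun x => -(convect U U x) - gradient P x) y =
      -(angularFluctVec (convect U U) y + angularFluctVec (gradient P) y) := fun y => by
    rw [angularFluctVec_neg_sub hW.continuous (continuous_gradient'' hP1'), neg_add']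
  simp_rw [hsplit, norm_neg]
  -- integrability of the two pieces in `L²_μ`
  have hVb := norm_angularFluctVec_convect_le h19 h21
  have iA : Integrable fun y => gaussWeight y * ‖angularFluctVec (convect U U) y‖ ^ 2 := by
    refine integrable_gaussWeight_mul_of_norm_le (cA.norm.pow 2) (C := (2 * (C₀ * C₁)) ^ 2) (N := 0)
      fun y => ?_
    rw [norm_pow, norm_norm, pow_zero, mul_one]
    refine pow_le_pow_left₀ (norm_nonneg _) ((hVb y).trans ?_) 2
    rw [div_le_iff₀ (by positivity)]
    nlinarith [pow_nonneg (norm_nonneg y) 3, mul_nonneg hC0 hC1]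
  have hgp : ∀ y, ‖angularFluctVec (gradient P) y‖ ≤ 2 * (C * (1 + ‖y‖) ^ N) := fun y =>
    norm_angularFluctVec_le (b := fun r => C * (1 + r) ^ N) hP1 y
  have iB : Integrable fun y => gaussWeight y * ‖angularFluctVec (gradient P) y‖ ^ 2 := by
    refine integrable_gaussWeight_mul_of_norm_le (cB.norm.pow 2) (C := (2 * C) ^ 2) (N := 2 * N) fun y => ?_
    rw [norm_pow, norm_norm]
    calc ‖angularFluctVec (gradient P) y‖ ^ 2 ≤ (2 * (C * (1 + ‖y‖) ^ N)) ^ 2 :=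
          pow_le_pow_left₀ (norm_nonneg _) (hgp y) 2
      _ = (2 * C) ^ 2 * (1 + ‖y‖) ^ (2 * N) := by ring
  have hM := sqrt_integral_gaussWeight_norm_add_sq_le' cA cB iA iB
  have h612 := sqrt_integral_gaussWeight_mul_norm_sq_angularFluctVec_convect_le hU1 h0 h1
  have h615 := pineauVicol_6_15 hU hP h19 h21 hs h22 hPois hP1 hε
  have hexp : 0 ≤ Real.exp ((max 1 ((24 * (C₀ * C₁) / ε) ^ ((2 : ℝ) / 3))) ^ 2 / 8) := (Real.exp_pos _).le
  have hUa : 0 ≤ Real.sqrt (∫ y, gaussWeight y * ‖angularFluctVec U y‖ ^ 2) := Real.sqrt_nonneg _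
  have hGa : 0 ≤ Real.sqrt (∫ y, gaussWeight y *
      ∑ i, ‖fderiv ℝ (angularFluctVec U) y (EuclideanSpace.basisFun (Fin 3) ℝ i)‖ ^ 2) :=
    Real.sqrt_nonneg _
  generalize Real.exp ((max 1 ((24 * (C₀ * C₁) / ε) ^ ((2 : ℝ) / 3))) ^ 2 / 8) = E at *
  generalize Real.sqrt (∫ y, gaussWeight y * ‖angularFluctVec U y‖ ^ 2) = Ua at *
  generalize Real.sqrt (∫ y, gaussWeight y *
      ∑ i, ‖fderiv ℝ (angularFluctVec U) y (EuclideanSpace.basisFun (Fin 3) ℝ i)‖ ^ 2) = Ga at *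
  have k1 := mul_nonneg hC0 hUa
  have k2 := mul_nonneg hexp k1
  have k3 := mul_nonneg hC1 hGa
  have k4 := mul_nonneg hexp k3
  have k5 := mul_nonneg hexp (mul_nonneg hC0 hGa)
  linarith [hM, h612, h615]

/-- **Pineau–Vicol 2026, Lemma 6.3, as printed (pp. 20–21).** "Assume that the smooth
incompressible vector field `U : ℝ³ → ℝ³` satisfies the bounds (1.9) and (2.1). Define
`𝓝 := −(U·∇)U − ∇P` (6.10), where `P = RᵢRⱼ(UᵢUⱼ)` (as in the proof of Lemma 2.1). For any
`ε ∈ (0,1]`, there exists a constant `C_ε = C_ε(ε, C_{U,0}) > 0` such that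
`‖(𝓝)_a‖_{L²_μ} ≤ ε + C_ε‖(U)_a‖_{L²_μ} + C_ε‖∇(U)_a‖_{L²_μ}` (6.11)." Rendering: the constant is
chosen before `U, P` from `(ε, C_{U,0}, C_{U,1})` (the printed `C_{U,1} = C_{U,1}(C_{U,0})` is
Lemma 2.1, not in the tree); the class is `U, P ∈ C²` with (1.9), the first half of (2.1), (2.2)
for one exponent `s = 2 − σ > 3/2`, the Poisson equation `ΔP = −∇·((U·∇)U)` of the Riesz pressure
(p. 9) and `∇P` of polynomial growth; any `ε > 0`. [cite: PineauVicol2026, Lemma 6.3 (p. 20)] -/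
theorem pineauVicol_lemma_6_3 (C₀ C₁ CP s : ℝ) (hs : 3 / 2 < s) {ε : ℝ} (hε : 0 < ε) :
    ∃ Cε : ℝ, 0 < Cε ∧
      ∀ (U : EuclideanSpace ℝ (Fin 3) → EuclideanSpace ℝ (Fin 3)) (P : EuclideanSpace ℝ (Fin 3) → ℝ),
        ContDiff ℝ 2 U → ContDiff ℝ 2 P →
        (∀ y, ‖U y‖ ≤ C₀ / (1 + ‖y‖)) → (∀ y, ‖fderiv ℝ U y‖ ≤ C₁ / (1 + ‖y‖ ^ 2)) →
        (∀ y, |P y| ≤ CP / (1 + ‖y‖ ^ s)) →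
        (∀ y, Δ P y = -VectorCalculus.divergence (convect U U) y) →
        ∀ (C : ℝ) (N : ℕ), (∀ y, ‖gradient P y‖ ≤ C * (1 + ‖y‖) ^ N) →
          Real.sqrt (∫ y, gaussWeight y *
              ‖angularFluctVec (fun x => -(convect U U x) - gradient P x) y‖ ^ 2) ≤
            ε + Cε * Real.sqrt (∫ y, gaussWeight y * ‖angularFluctVec U y‖ ^ 2) +
              Cε * Real.sqrt (∫ y, gaussWeight y *
                ∑ i, ‖fderiv ℝ (angularFluctVec U) y (EuclideanSpace.basisFun (Fin 3) ℝ i)‖ ^ 2) := by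
  set E := Real.exp ((max 1 ((24 * (C₀ * C₁) / ε) ^ ((2 : ℝ) / 3))) ^ 2 / 8) with hE
  refine ⟨(1 + 9 * E) * (|C₁| + 3 * |C₀|) + 1, by positivity, ?_⟩
  intro U P hU hP h19 h21 h22 hPois C N hP1
  have hC0 : 0 ≤ C₀ := by
    have h := (norm_nonneg _).trans (h19 0); rw [norm_zero] at h; norm_num at h; exact h
  have hC1 : 0 ≤ C₁ := by
    have h := (norm_nonneg _).trans (h21 0); rw [norm_zero] at h; norm_num at h; exact h
  have h := pineauVicol_6_11 hU hP h19 h21 hs h22 hPois hP1 hε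
  rw [← hE] at h
  rw [abs_of_nonneg hC0, abs_of_nonneg hC1]
  have hUa : 0 ≤ Real.sqrt (∫ y, gaussWeight y * ‖angularFluctVec U y‖ ^ 2) := Real.sqrt_nonneg _
  have hGa : 0 ≤ Real.sqrt (∫ y, gaussWeight y *
      ∑ i, ‖fderiv ℝ (angularFluctVec U) y (EuclideanSpace.basisFun (Fin 3) ℝ i)‖ ^ 2) :=
    Real.sqrt_nonneg _
  nlinarith [hUa, hGa]

/-! ### Proposition 6.5 (6.20), unconditional -/

/-- **Pineau–Vicol 2026, Proposition 6.5 (6.20) (p. 22) with the printed threshold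
`A_ε = (27/2) C_{ε/6}²`**: for `U, P ∈ C²` solving (6.16a)
`α𝓡U + ½U + ½(y·∇)U − ΔU + (U·∇)U + ∇P = 0` pointwise, in the decay class (1.9), (2.1), (2.2)
(one exponent `s = 2 − σ > 3/2`), with the Poisson equation `ΔP = −∇·((U·∇)U)` and `∇P` of
polynomial growth: if `|α| ≥ (27/2) C²` with `C = (1 + 9e^{L²/8})(C_{U,1} + 3C_{U,0})`,
`L = max{1, (144 C_{U,0}C_{U,1}/ε)^{2/3}}` (the constant of (6.11) at level `ε/6`), then
`|α| ‖𝓡U‖_{L²_μ} ≤ ε`. Proof: (6.11) (`pineauVicol_6_11`) inserted into the companion file's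
`pineauVicol_prop_6_5_of_source_bound` (the printed algebra with (6.17) and Young's inequality).
[cite: PineauVicol2026, Proposition 6.5 (6.20) and its proof (p. 22)] -/
theorem pineauVicol_prop_6_5 {U : EuclideanSpace ℝ (Fin 3) → EuclideanSpace ℝ (Fin 3)}
    {P : EuclideanSpace ℝ (Fin 3) → ℝ} {α : ℝ} (hU : ContDiff ℝ 2 U) (hP : ContDiff ℝ 2 P)
    {C₀ C₁ C₂ CP s : ℝ}
    (h19 : ∀ y, ‖U y‖ ≤ C₀ / (1 + ‖y‖)) (h21 : ∀ y, ‖fderiv ℝ U y‖ ≤ C₁ / (1 + ‖y‖ ^ 2))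
    (h21' : ∀ y, ‖fderiv ℝ (fderiv ℝ U) y‖ ≤ C₂ / (1 + ‖y‖ ^ 3))
    (hs : 3 / 2 < s) (h22 : ∀ y, |P y| ≤ CP / (1 + ‖y‖ ^ s))
    (hPois : ∀ y, Δ P y = -VectorCalculus.divergence (convect U U) y)
    {C : ℝ} {N : ℕ} (hP1 : ∀ y, ‖gradient P y‖ ≤ C * (1 + ‖y‖) ^ N)
    (heq : ∀ y, α • (rotGen (U y) - fderiv ℝ U y (rotGen y)) + (1 / 2 : ℝ) • U y +
      (1 / 2 : ℝ) • fderiv ℝ U y y - (Δ U) y + convect U U y + gradient P y = 0)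
    {ε : ℝ} (hε : 0 < ε)
    (hα : 27 / 2 * ((1 + 9 * Real.exp ((max 1 ((24 * (C₀ * C₁) / (ε / 6)) ^ ((2 : ℝ) / 3))) ^ 2 / 8)) *
      (C₁ + 3 * C₀)) ^ 2 ≤ |α|) :
    |α| * Real.sqrt (∫ y, gaussWeight y * ‖rotGen (U y) - fderiv ℝ U y (rotGen y)‖ ^ 2) ≤ ε := by
  have hC0 : 0 ≤ C₀ := by
    have h := (norm_nonneg _).trans (h19 0); rw [norm_zero] at h; norm_num at h; exact h
  have hC1 : 0 ≤ C₁ := by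
    have h := (norm_nonneg _).trans (h21 0); rw [norm_zero] at h; norm_num at h; exact h
  -- one growth constant for the companion file's hypotheses
  set K := C₀ + C₁ + |C₂| + |C| with hK
  have hK0 : 0 ≤ K := by positivity
  have hpow : ∀ y : EuclideanSpace ℝ (Fin 3), (1 : ℝ) ≤ (1 + ‖y‖) ^ N := fun y =>
    one_le_pow₀ (by linarith [norm_nonneg y])
  have hKp : ∀ y : EuclideanSpace ℝ (Fin 3), K ≤ K * (1 + ‖y‖) ^ N := fun y =>
    le_mul_of_one_le_right hK0 (hpow y)
  have hK1 : C₀ ≤ K := by rw [hK]; linarith [abs_nonneg C₂, abs_nonneg C]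
  have hK2 : C₁ ≤ K := by rw [hK]; linarith [abs_nonneg C₂, abs_nonneg C]
  have hK3 : |C₂| ≤ K := by rw [hK]; linarith [abs_nonneg C]
  have hK4 : |C| ≤ K := by rw [hK]; linarith [abs_nonneg C₂]
  have hU0 : ∀ y, ‖U y‖ ≤ K * (1 + ‖y‖) ^ N := fun y => by
    have h := (h19 y).trans (div_le_self hC0 (by linarith [norm_nonneg y]))
    linarith [hKp y]
  have hU1 : ∀ y, ‖fderiv ℝ U y‖ ≤ K * (1 + ‖y‖) ^ N := fun y => by
    have h := (h21 y).trans (div_le_self hC1 (by nlinarith [norm_nonneg y]))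
    linarith [hKp y]
  have hU2 : ∀ y, ‖fderiv ℝ (fderiv ℝ U) y‖ ≤ K * (1 + ‖y‖) ^ N := fun y => by
    have h := (h21' y).trans ((div_le_div_of_nonneg_right (le_abs_self C₂)
      (by nlinarith [pow_nonneg (norm_nonneg y) 3])).trans
      (div_le_self (abs_nonneg C₂) (by nlinarith [pow_nonneg (norm_nonneg y) 3])))
    linarith [hKp y]
  have hP1K : ∀ y, ‖gradient P y‖ ≤ K * (1 + ‖y‖) ^ N := fun y =>
    (hP1 y).trans (mul_le_mul_of_nonneg_right ((le_abs_self C).trans hK4) (by positivity))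
  have hε6 : 0 < ε / 6 := by positivity
  have h611 := pineauVicol_6_11 hU hP h19 h21 hs h22 hPois hP1 hε6
  exact pineauVicol_prop_6_5_of_source_bound hU (hP.of_le one_le_two) hU0 hU1 hU2 hP1K heq hε.le
    h611 hα

/-- **Pineau–Vicol 2026, Proposition 6.5, as printed (p. 22).** "Let `α ∈ ℝ` and let `U` be a
smooth solution of (6.16) which satisfies the bounds (1.9) and (2.1). Let `ε ∈ (0,1]` be
arbitrary. Then, there exists a constant `A_ε = A(ε, C_{U,0}) ≥ 1`, such that for all
`|α| ≥ A_ε` we have `|α| ‖𝓡U‖_{L²_μ} ≤ ε` (6.20)." Rendering: `A` is chosen before `U, P, α` from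
`(ε, C_{U,0}, C_{U,1})`; the class is that of `pineauVicol_prop_6_5` ((6.16a) pointwise for
`U, P ∈ C²`, (1.9), (2.1), (2.2) with one exponent `s > 3/2`, the Poisson equation of the Riesz
pressure, `∇P` of polynomial growth); any `ε > 0`. [cite: PineauVicol2026, Proposition 6.5 (6.20) (p. 22)] -/
theorem pineauVicol_prop_6_5_exists (C₀ C₁ C₂ CP s : ℝ) (hs : 3 / 2 < s) {ε : ℝ} (hε : 0 < ε) :
    ∃ A : ℝ, 1 ≤ A ∧
      ∀ (U : EuclideanSpace ℝ (Fin 3) → EuclideanSpace ℝ (Fin 3)) (P : EuclideanSpace ℝ (Fin 3) → ℝ)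
        (α : ℝ), ContDiff ℝ 2 U → ContDiff ℝ 2 P →
        (∀ y, ‖U y‖ ≤ C₀ / (1 + ‖y‖)) → (∀ y, ‖fderiv ℝ U y‖ ≤ C₁ / (1 + ‖y‖ ^ 2)) →
        (∀ y, ‖fderiv ℝ (fderiv ℝ U) y‖ ≤ C₂ / (1 + ‖y‖ ^ 3)) →
        (∀ y, |P y| ≤ CP / (1 + ‖y‖ ^ s)) →
        (∀ y, Δ P y = -VectorCalculus.divergence (convect U U) y) →
        (∀ y, α • (rotGen (U y) - fderiv ℝ U y (rotGen y)) + (1 / 2 : ℝ) • U y +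
          (1 / 2 : ℝ) • fderiv ℝ U y y - (Δ U) y + convect U U y + gradient P y = 0) →
        ∀ (C : ℝ) (N : ℕ), (∀ y, ‖gradient P y‖ ≤ C * (1 + ‖y‖) ^ N) →
          A ≤ |α| →
            |α| * Real.sqrt (∫ y, gaussWeight y * ‖rotGen (U y) - fderiv ℝ U y (rotGen y)‖ ^ 2) ≤ ε := by
  refine ⟨max 1 (27 / 2 * ((1 + 9 * Real.exp ((max 1 ((24 * (C₀ * C₁) / (ε / 6)) ^ ((2 : ℝ) / 3))) ^ 2 / 8)) *
      (C₁ + 3 * C₀)) ^ 2), le_max_left _ _, ?_⟩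
  intro U P α hU hP h19 h21 h21' h22 hPois heq C N hP1 hA
  exact pineauVicol_prop_6_5 hU hP h19 h21 h21' hs h22 hPois hP1 heq hε ((le_max_right _ _).trans hA)

/-! ### The growth of `∇P` from (6.16a): Proposition 6.5 with the printed hypotheses on `U` only -/

/-- The second partial `∂ᵥ∂ₑU` as the second derivative: `D(z ↦ DU(z)[e])(x)[v] = D²U(x)[v][e]`.
[folklore] -/
private theorem fderiv_fderiv_apply_eq_aux {U : EuclideanSpace ℝ (Fin 3) → EuclideanSpace ℝ (Fin 3)}
    (hU : ContDiff ℝ 2 U) (x e v : EuclideanSpace ℝ (Fin 3)) :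
    fderiv ℝ (fun z => fderiv ℝ U z e) x v = fderiv ℝ (fderiv ℝ U) x v e := by
  have hd : DifferentiableAt ℝ (fderiv ℝ U) x :=
    ((hU.fderiv_right (m := 1) le_rfl).differentiable one_ne_zero) x
  rw [fderiv_clm_apply hd (differentiableAt_const e)]
  simp

/-- `|ΔU(x)| ≤ 3 ‖D²U(x)‖` on `ℝ³` (the Laplacian is the trace of the Hessian). [folklore] -/
private theorem norm_laplacian_le_three_mul_aux {U : EuclideanSpace ℝ (Fin 3) → EuclideanSpace ℝ (Fin 3)}
    (hU : ContDiff ℝ 2 U) (x : EuclideanSpace ℝ (Fin 3)) :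
    ‖(Δ U) x‖ ≤ 3 * ‖fderiv ℝ (fderiv ℝ U) x‖ := by
  have h1 : ∀ i, ‖EuclideanSpace.basisFun (Fin 3) ℝ i‖ = 1 :=
    (EuclideanSpace.basisFun (Fin 3) ℝ).orthonormal.1
  rw [laplacian_eq_sum_fderiv_fderiv (EuclideanSpace.basisFun (Fin 3) ℝ) hU x]
  calc ‖∑ i, fderiv ℝ (fun z => fderiv ℝ U z (EuclideanSpace.basisFun (Fin 3) ℝ i)) x
        (EuclideanSpace.basisFun (Fin 3) ℝ i)‖
      ≤ ∑ i, ‖fderiv ℝ (fun z => fderiv ℝ U z (EuclideanSpace.basisFun (Fin 3) ℝ i)) x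
        (EuclideanSpace.basisFun (Fin 3) ℝ i)‖ := norm_sum_le _ _
    _ ≤ ∑ _i : Fin 3, ‖fderiv ℝ (fderiv ℝ U) x‖ := Finset.sum_le_sum fun i _ => by
        rw [fderiv_fderiv_apply_eq_aux hU]
        calc ‖fderiv ℝ (fderiv ℝ U) x (EuclideanSpace.basisFun (Fin 3) ℝ i)
              (EuclideanSpace.basisFun (Fin 3) ℝ i)‖
            ≤ ‖fderiv ℝ (fderiv ℝ U) x (EuclideanSpace.basisFun (Fin 3) ℝ i)‖ *
                ‖EuclideanSpace.basisFun (Fin 3) ℝ i‖ := ContinuousLinearMap.le_opNorm _ _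
          _ ≤ (‖fderiv ℝ (fderiv ℝ U) x‖ * ‖EuclideanSpace.basisFun (Fin 3) ℝ i‖) *
                ‖EuclideanSpace.basisFun (Fin 3) ℝ i‖ :=
              mul_le_mul_of_nonneg_right (ContinuousLinearMap.le_opNorm _ _) (norm_nonneg _)
          _ = ‖fderiv ℝ (fderiv ℝ U) x‖ := by rw [h1 i, mul_one, mul_one]
    _ = 3 * ‖fderiv ℝ (fderiv ℝ U) x‖ := by rw [Fin.sum_univ_three]; ring

/-- `‖a + b + c − d + e‖ ≤ ‖a‖ + ‖b‖ + ‖c‖ + ‖d‖ + ‖e‖`. [folklore] -/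
private theorem norm_add_add_sub_add_le {F : Type*} [SeminormedAddCommGroup F] (a b c d e : F) :
    ‖a + b + c - d + e‖ ≤ ‖a‖ + ‖b‖ + ‖c‖ + ‖d‖ + ‖e‖ := by
  have h₁ := norm_add_le (a + b + c - d) e
  have h₂ := norm_sub_le (a + b + c) d
  have h₃ := norm_add_le (a + b) c
  have h₄ := norm_add_le a b
  linarith

/-- **The growth of `∇P` is a consequence of (6.16a)**: for a `C²` solution of
`α𝓡U + ½U + ½(y·∇)U − ΔU + (U·∇)U + ∇P = 0` with `|U| ≤ C_{U,0}`, `|DU| ≤ C_{U,1}`, `|D²U| ≤ C_{U,2}`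
(consequences of the printed (1.9), (2.1)),
`|∇P(y)| ≤ (|α|(C_{U,0} + C_{U,1}) + C_{U,0} + C_{U,1} + 3C_{U,2} + C_{U,0}C_{U,1})(1 + |y|)`
(read off the equation term by term; `|𝓡U| ≤ |U| + |DU| |Jy|`, `|Jy| ≤ |y|`, `|ΔU| ≤ 3|D²U|`).
[cite: PineauVicol2026, (6.16a) (p. 21) and (1.8a) (p. 3)] -/
theorem norm_gradient_le_of_profile_equation
    {U : EuclideanSpace ℝ (Fin 3) → EuclideanSpace ℝ (Fin 3)} {P : EuclideanSpace ℝ (Fin 3) → ℝ} {α : ℝ}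
    (hU : ContDiff ℝ 2 U) {C₀ C₁ C₂ : ℝ} (h0 : ∀ y, ‖U y‖ ≤ C₀) (h1 : ∀ y, ‖fderiv ℝ U y‖ ≤ C₁)
    (h2 : ∀ y, ‖fderiv ℝ (fderiv ℝ U) y‖ ≤ C₂)
    (heq : ∀ y, α • (rotGen (U y) - fderiv ℝ U y (rotGen y)) + (1 / 2 : ℝ) • U y +
      (1 / 2 : ℝ) • fderiv ℝ U y y - (Δ U) y + convect U U y + gradient P y = 0)
    (y : EuclideanSpace ℝ (Fin 3)) :
    ‖gradient P y‖ ≤ (|α| * (C₀ + C₁) + C₀ + C₁ + 3 * C₂ + C₀ * C₁) * (1 + ‖y‖) ^ 1 := by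
  have hy : 0 ≤ ‖y‖ := norm_nonneg y
  have ha : 0 ≤ |α| := abs_nonneg α
  have hC0 : 0 ≤ C₀ := (norm_nonneg _).trans (h0 0)
  have hC1 : 0 ≤ C₁ := (norm_nonneg _).trans (h1 0)
  -- the five terms of (6.16a) other than `∇P`
  have hL : ‖(Δ U) y‖ ≤ 3 * C₂ :=
    (norm_laplacian_le_three_mul_aux hU y).trans (mul_le_mul_of_nonneg_left (h2 y) (by norm_num))
  have hC2 : 0 ≤ C₂ := by
    have h := (norm_nonneg ((Δ U) 0)).trans ((norm_laplacian_le_three_mul_aux hU 0).trans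
      (mul_le_mul_of_nonneg_left (h2 0) (by norm_num)))
    linarith
  have na : ‖α • (rotGen (U y) - fderiv ℝ U y (rotGen y))‖ ≤ |α| * (C₀ + C₁ * ‖y‖) := by
    rw [norm_smul, Real.norm_eq_abs]
    refine mul_le_mul_of_nonneg_left ?_ ha
    calc ‖rotGen (U y) - fderiv ℝ U y (rotGen y)‖ ≤ ‖rotGen (U y)‖ + ‖fderiv ℝ U y (rotGen y)‖ :=
          norm_sub_le _ _
      _ ≤ C₀ + C₁ * ‖y‖ := add_le_add ((norm_rotGen_le _).trans (h0 y))
          ((ContinuousLinearMap.le_opNorm _ _).trans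
            (mul_le_mul (h1 y) (norm_rotGen_le y) (norm_nonneg _) hC1))
  have nb : ‖(1 / 2 : ℝ) • U y‖ ≤ 1 / 2 * C₀ := by
    rw [norm_smul, Real.norm_of_nonneg (by norm_num : (0 : ℝ) ≤ 1 / 2)]
    exact mul_le_mul_of_nonneg_left (h0 y) (by norm_num)
  have nc : ‖(1 / 2 : ℝ) • fderiv ℝ U y y‖ ≤ 1 / 2 * (C₁ * ‖y‖) := by
    rw [norm_smul, Real.norm_of_nonneg (by norm_num : (0 : ℝ) ≤ 1 / 2)]
    exact mul_le_mul_of_nonneg_left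
      ((ContinuousLinearMap.le_opNorm _ _).trans (mul_le_mul_of_nonneg_right (h1 y) hy)) (by norm_num)
  have ne : ‖convect U U y‖ ≤ C₁ * C₀ := by
    rw [convect_apply]
    exact (ContinuousLinearMap.le_opNorm _ _).trans (mul_le_mul (h1 y) (h0 y) (norm_nonneg _) hC1)
  have hg : gradient P y = -(α • (rotGen (U y) - fderiv ℝ U y (rotGen y)) + (1 / 2 : ℝ) • U y +
      (1 / 2 : ℝ) • fderiv ℝ U y y - (Δ U) y + convect U U y) := by
    rw [eq_neg_iff_add_eq_zero, add_comm]; exact heq y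
  have hsum := norm_add_add_sub_add_le (α • (rotGen (U y) - fderiv ℝ U y (rotGen y)))
    ((1 / 2 : ℝ) • U y) ((1 / 2 : ℝ) • fderiv ℝ U y y) ((Δ U) y) (convect U U y)
  rw [hg, norm_neg, pow_one]
  linarith [mul_nonneg ha hC1, mul_nonneg (mul_nonneg ha hC0) hy, mul_nonneg hC0 hy,
    mul_nonneg hC1 hy, mul_nonneg hC2 hy, mul_nonneg (mul_nonneg hC0 hC1) hy]

/-- **Pineau–Vicol 2026, Proposition 6.5 (6.20), with the printed hypotheses on the profile only**
("a smooth solution of (6.16) which satisfies the bounds (1.9) and (2.1)"): as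
`pineauVicol_prop_6_5`, but the polynomial growth of `∇P` is read off (6.16a)
(`norm_gradient_le_of_profile_equation`) instead of being assumed; `P` enters only through
`P ∈ C²`, the Poisson equation of the Riesz pressure and the decay (2.2) (one exponent `s > 3/2`).
[cite: PineauVicol2026, Proposition 6.5 (6.20) (p. 22)] -/
theorem pineauVicol_prop_6_5' {U : EuclideanSpace ℝ (Fin 3) → EuclideanSpace ℝ (Fin 3)}
    {P : EuclideanSpace ℝ (Fin 3) → ℝ} {α : ℝ} (hU : ContDiff ℝ 2 U) (hP : ContDiff ℝ 2 P)
    {C₀ C₁ C₂ CP s : ℝ}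
    (h19 : ∀ y, ‖U y‖ ≤ C₀ / (1 + ‖y‖)) (h21 : ∀ y, ‖fderiv ℝ U y‖ ≤ C₁ / (1 + ‖y‖ ^ 2))
    (h21' : ∀ y, ‖fderiv ℝ (fderiv ℝ U) y‖ ≤ C₂ / (1 + ‖y‖ ^ 3))
    (hs : 3 / 2 < s) (h22 : ∀ y, |P y| ≤ CP / (1 + ‖y‖ ^ s))
    (hPois : ∀ y, Δ P y = -VectorCalculus.divergence (convect U U) y)
    (heq : ∀ y, α • (rotGen (U y) - fderiv ℝ U y (rotGen y)) + (1 / 2 : ℝ) • U y +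
      (1 / 2 : ℝ) • fderiv ℝ U y y - (Δ U) y + convect U U y + gradient P y = 0)
    {ε : ℝ} (hε : 0 < ε)
    (hα : 27 / 2 * ((1 + 9 * Real.exp ((max 1 ((24 * (C₀ * C₁) / (ε / 6)) ^ ((2 : ℝ) / 3))) ^ 2 / 8)) *
      (C₁ + 3 * C₀)) ^ 2 ≤ |α|) :
    |α| * Real.sqrt (∫ y, gaussWeight y * ‖rotGen (U y) - fderiv ℝ U y (rotGen y)‖ ^ 2) ≤ ε := by
  have hC0 : 0 ≤ C₀ := by
    have h := (norm_nonneg _).trans (h19 0); rw [norm_zero] at h; norm_num at h; exact h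
  have hC1 : 0 ≤ C₁ := by
    have h := (norm_nonneg _).trans (h21 0); rw [norm_zero] at h; norm_num at h; exact h
  have h0 : ∀ y, ‖U y‖ ≤ C₀ := fun y =>
    (h19 y).trans (div_le_self hC0 (by linarith [norm_nonneg y]))
  have h1 : ∀ y, ‖fderiv ℝ U y‖ ≤ C₁ := fun y =>
    (h21 y).trans (div_le_self hC1 (by nlinarith [norm_nonneg y]))
  have h2 : ∀ y, ‖fderiv ℝ (fderiv ℝ U) y‖ ≤ |C₂| := fun y =>
    (h21' y).trans ((div_le_div_of_nonneg_right (le_abs_self C₂)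
      (by nlinarith [pow_nonneg (norm_nonneg y) 3])).trans
      (div_le_self (abs_nonneg C₂) (by nlinarith [pow_nonneg (norm_nonneg y) 3])))
  have hP1 := norm_gradient_le_of_profile_equation hU h0 h1 h2 heq
  exact pineauVicol_prop_6_5 hU hP h19 h21 h21' hs h22 hPois hP1 heq hε hα

/-- **Pineau–Vicol 2026, Proposition 6.5, as printed (p. 22), hypotheses on the profile only** — the
`∃ A_ε ≥ 1` form of `pineauVicol_prop_6_5'`. [cite: PineauVicol2026, Proposition 6.5 (6.20) (p. 22)] -/
theorem pineauVicol_prop_6_5_exists' (C₀ C₁ C₂ CP s : ℝ) (hs : 3 / 2 < s) {ε : ℝ} (hε : 0 < ε) :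
    ∃ A : ℝ, 1 ≤ A ∧
      ∀ (U : EuclideanSpace ℝ (Fin 3) → EuclideanSpace ℝ (Fin 3)) (P : EuclideanSpace ℝ (Fin 3) → ℝ)
        (α : ℝ), ContDiff ℝ 2 U → ContDiff ℝ 2 P →
        (∀ y, ‖U y‖ ≤ C₀ / (1 + ‖y‖)) → (∀ y, ‖fderiv ℝ U y‖ ≤ C₁ / (1 + ‖y‖ ^ 2)) →
        (∀ y, ‖fderiv ℝ (fderiv ℝ U) y‖ ≤ C₂ / (1 + ‖y‖ ^ 3)) →
        (∀ y, |P y| ≤ CP / (1 + ‖y‖ ^ s)) →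
        (∀ y, Δ P y = -VectorCalculus.divergence (convect U U) y) →
        (∀ y, α • (rotGen (U y) - fderiv ℝ U y (rotGen y)) + (1 / 2 : ℝ) • U y +
          (1 / 2 : ℝ) • fderiv ℝ U y y - (Δ U) y + convect U U y + gradient P y = 0) →
          A ≤ |α| →
            |α| * Real.sqrt (∫ y, gaussWeight y * ‖rotGen (U y) - fderiv ℝ U y (rotGen y)‖ ^ 2) ≤ ε := by
  refine ⟨max 1 (27 / 2 * ((1 + 9 * Real.exp ((max 1 ((24 * (C₀ * C₁) / (ε / 6)) ^ ((2 : ℝ) / 3))) ^ 2 / 8)) *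
      (C₁ + 3 * C₀)) ^ 2), le_max_left _ _, ?_⟩
  intro U P α hU hP h19 h21 h21' h22 hPois heq hA
  exact pineauVicol_prop_6_5' hU hP h19 h21 h21' hs h22 hPois heq hε ((le_max_right _ _).trans hA)

end PineauVicol2026

end Literature.Analysis.FluidPDE
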